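import Literature.Geometry.Lorentzian.TeukolskyRealAxisModeStability
import Literature.Geometry.Lorentzian.TeukolskyRadialHeunForm
import Literature.Geometry.Lorentzian.KerrSeparatedPotential
import Literature.Geometry.Lorentzian.KerrTortoiseRadius
import Literature.Analysis.ODE.ComplexSecondOrder
import Mathlib.MeasureTheory.Integral.IntegralEqImproper
import Mathlib.MeasureTheory.Integral.ExpDecay
import Mathlib.Analysis.SpecialFunctions.Integrals.Basic
import Mathlib.Analysis.SpecialFunctions.Pow.Asymptotics
import Mathlib.Analysis.Calculus.ParametricIntegral
import Mathlib.Analysis.Calculus.Taylor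
import Mathlib.Analysis.SpecialFunctions.Complex.Analytic
import HarnessLib

/-!
# Real-axis mode stability for the Teukolsky equation (Teixeira da Costa 2020, Thm. 4.1):
# proofs, part 1 — the unique continuation lemma (§4.1, Lemma 4.1)

This file starts the proof of the named fact
`Literature.Geometry.Lorentzian.Kerr.Costa2019_realAxisModeStability`
(`TeukolskyRealAxisModeStability.lean`; R. Teixeira da Costa, *Mode stability for the Teukolsky
equation on extremal and subextremal Kerr spacetimes*, Commun. Math. Phys. 378 (2020) 705–781 =
arXiv:1910.02854 [Costa2019], Theorem 4.1, subextremal case), following the printed proof (§4):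

* §4.2 (`s ≤ 0`): the Whiting–Shlapentokh-Rothman integral transform `R ↦ ũ` (Prop. 3.8) turns an
  outgoing solution of the radial ODE into a bounded solution of `ũ'' + Ṽ ũ = 0` on the line
  `x* ∈ ℝ` with REAL potential `Ṽ`, `Ṽ → ω²(r₊−r₋)²/r₊²` at `−∞` and `Ṽ → ω²` at `+∞` at integrable
  rates; conservation of the `T`-current `Im(ũ' \overline{ω ũ})` and the boundary behaviour of `ũ`
  force `ũ, ũ' → 0` at both ends, and the **unique continuation lemma** (Lemma 4.1) gives `ũ ≡ 0`,
  whence `R ≡ 0` by injectivity of the transform;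
* §4.3 (`s > 0`): reduction to `−s` by the Teukolsky–Starobinsky identities (Prop. 2.14).

**This part** proves Lemma 4.1 ("A unique continuation lemma", in the style of
Shlapentokh-Rothman, AHP 16 (2015)): a bounded `C²` solution `u : ℝ → 𝕜` (`𝕜 = ℝ` or `ℂ`) of
`u'' + V u = 0`, `V` real and continuous, which together with `u'` tends to `0` at one end where
`V` tends to a NON-ZERO constant `ω₀²` at an integrable rate, vanishes identically
(`Costa2019.uniqueContinuation_atBot`, statement (2) of the printed lemma; the mirrored
`Costa2019.uniqueContinuation_atTop`, statement (1)). The proof is the printed energy-current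
argument with one simplification: instead of the current `Q^y = y|u'|² + yV|u|²` (whose derivative
involves `V'`) we use `P = y(|u'|² + ω₀²|u|²)`, `P' = y'(|u'|² + ω₀²|u|²) + 2y(ω₀² − V) Re(ū u')`,
so that `V` is never differentiated and no integration by parts is needed; the weight is the
printed one, `y = −exp(−C ∫ ζ)` with `ζ := |ω₀² − V| + (a positive sigmoid)`, `C = 2/|ω₀|`, and
the error term is absorbed exactly as printed:
`|2y(ω₀² − V) ū u'| ≤ (y'/C)·2|u||u'| ≤ y'(|u'|² + ω₀²|u|²)/(C|ω₀|) = ½ y'(|u'|² + ω₀²|u|²)`.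
Then `0 = P(+∞) − P(−∞) = ∫ P'` gives `∫ y'(|u'|² + ω₀²|u|²) ≤ 0` with `y' > 0`, so `u ≡ 0`.

**Part 2** (same file, `Costa2019.transformedSolution_eq_zero`): the deduction of §4.2 for
`|a| < M` and real `ω ≠ 0` in abstract form — a bounded `C²` solution `v` of `v'' + W v = 0`
(`W` real, `W(−∞) = ω₀²` at an integrable rate) with the boundary behaviour of Prop. 3.8 (4),
`v' + iω₀v → 0` at `−∞` and `v' − iωv → 0` at `+∞` (`ωω₀ > 0`), vanishes identically: the
`T`-current `ω Im(v' v̄)` is conserved (`Costa2019.hasDerivAt_tCurrent`), which forces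
`ω²|v|² → Q₀ ≥ 0` at `+∞` and `ωω₀|v|² → −Q₀ ≥ 0` at `−∞`, so `Q₀ = 0`, `v, v' → 0` at `−∞`,
and Lemma 4.1 applies. With this, Theorem 4.1 for `s ≤ 0` is reduced to Prop. 3.8 (the
transform `R ↦ ũ`, its equation, bounds, boundary behaviour and injectivity).

**Part 3** (same file): two inputs of the proof of Prop. 3.8 —
`Costa2019.contDiffOn_of_isRadialTeukolskySolution` (classical solutions of the radial ODE are
`C^∞` on `(r₊, ∞)`, the regularity used by the integrations by parts of Lemma 3.10; Hartman
Ch. V Cor. 4.1 via `Literature.Analysis.ODE.contDiffOn_of_solution`) and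
`Costa2019.lagrange_identity` (Lemma 3.13 in differential form, for an arbitrary operator
`D∂² + P∂ + Q` with a weight `w`, `w' = wχ`, `Dχ + D' = P`); and the first item of the
asymptotic toolkit that turns the outgoing expansion of `R` at infinity into derivative bounds,
Landau's interval inequality `‖f'(x)‖ ≤ 2‖f‖_∞/h + h‖f''‖_∞/2` (`Costa2019.norm_deriv_le_landau`),
and the polynomial energy growth `‖R'‖² + ω²‖R‖² ≤ E(X)(r/X)^κ` for `R'' = pR' + qR` with
`p = O(1/r)`, `q = −ω² + O(1/r)` (`Costa2019.energy_le_mul_rpow_of_ode`), which supplies the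
polynomial bounds on `R'` at infinity used for the boundary terms of Lemma 3.12 at `Im z ≠ 0`.

Everything here is proved (no new named facts, D-0026); theorems only.

## References
* R. Teixeira da Costa, CMP 378 (2020) 705–781, arXiv:1910.02854, §4.1 Lemma 4.1. [Costa2019]
* Y. Shlapentokh-Rothman, Ann. Henri Poincaré 16 (2015) 289–345, arXiv:1302.6902 (the `s = 0`
  unique continuation lemma). [ShlapentokhRothman2015ModeStability]
-/

noncomputable section

open Set Filter MeasureTheory Topology intervalIntegral ComplexConjugate

namespace Literature.Geometry.Lorentzian.Kerr

namespace Costa2019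

variable {𝕜 : Type*} [RCLike 𝕜]

/-! ### Small algebraic and calculus helpers -/

/-- `Re(ā b) = Re(b̄ a)`. [folklore] -/
theorem re_conj_mul_swap (a b : 𝕜) : RCLike.re (conj a * b) = RCLike.re (conj b * a) := by
  rw [← RCLike.conj_re (conj a * b), map_mul, RCLike.conj_conj, mul_comm]

/-- `|Re(ā b)| ≤ ‖a‖ ‖b‖`. [folklore] -/
theorem abs_re_conj_mul_le (a b : 𝕜) : |RCLike.re (conj a * b)| ≤ ‖a‖ * ‖b‖ := by
  calc |RCLike.re (conj a * b)| ≤ ‖conj a * b‖ := RCLike.abs_re_le_norm _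
    _ = ‖a‖ * ‖b‖ := by rw [norm_mul, RCLike.norm_conj]

/-- The sigmoid `eᵗ/(1 + eᵗ)` is positive. [folklore] -/
theorem sigmoid_pos (t : ℝ) : 0 < Real.exp t / (1 + Real.exp t) := by positivity

/-- The sigmoid is dominated by `eᵗ` (integrable at `−∞`). [folklore] -/
theorem sigmoid_le_exp (t : ℝ) : Real.exp t / (1 + Real.exp t) ≤ Real.exp t :=
  div_le_self (Real.exp_pos t).le (le_add_of_nonneg_right (Real.exp_pos t).le)

/-- The sigmoid is at least `1/2` on `[0, ∞)` (not integrable at `+∞`). [folklore] -/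
theorem half_le_sigmoid {t : ℝ} (ht : 0 ≤ t) : 1 / 2 ≤ Real.exp t / (1 + Real.exp t) := by
  have h1 : 1 ≤ Real.exp t := Real.one_le_exp ht
  rw [div_le_div_iff₀ (by norm_num) (by positivity)]
  linarith

/-- The sigmoid is continuous. [folklore] -/
theorem continuous_sigmoid : Continuous fun t : ℝ => Real.exp t / (1 + Real.exp t) :=
  Real.continuous_exp.div (continuous_const.add Real.continuous_exp) fun t => by positivity

/-- `∫ₓ^{x₀} e^{t − x₀}/(1 + e^{t − x₀}) dt ≤ 1` for `x ≤ x₀`. [folklore] -/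
theorem integral_sigmoid_le_one {x x₀ : ℝ} (hx : x ≤ x₀) :
    ∫ t in x..x₀, Real.exp (t - x₀) / (1 + Real.exp (t - x₀)) ≤ 1 := by
  have hc : Continuous fun t : ℝ => Real.exp (t - x₀) / (1 + Real.exp (t - x₀)) :=
    continuous_sigmoid.comp (continuous_id.sub continuous_const)
  calc ∫ t in x..x₀, Real.exp (t - x₀) / (1 + Real.exp (t - x₀))
      ≤ ∫ t in x..x₀, Real.exp (t - x₀) :=
        integral_mono_on hx (hc.intervalIntegrable _ _)
          ((Real.continuous_exp.comp (continuous_id.sub continuous_const)).intervalIntegrable _ _)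
          fun t _ => sigmoid_le_exp _
    _ = Real.exp (x₀ - x₀) - Real.exp (x - x₀) := by
        rw [intervalIntegral.integral_comp_sub_right (fun t => Real.exp t) x₀, integral_exp]
    _ ≤ 1 := by rw [sub_self, Real.exp_zero]; linarith [Real.exp_pos (x - x₀)]

/-! ### Lemma 4.1: unique continuation at an end where `V → ω₀² ≠ 0` -/

/-- **Unique continuation lemma** (Teixeira da Costa 2020, Lemma 4.1, statement (2); after
Shlapentokh-Rothman 2015). Let `u : ℝ → 𝕜` be `C²` with `u'' + V u = 0` for a real continuous
potential `V`; assume `u` and `u'` are bounded on `ℝ`, `(|u| + |u'|)(−∞) = 0`, and that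
`V̂ := ω₀² − V` "decays at an integrable rate as `x → −∞`" for some `ω₀ ≠ 0`, in the elementary
form `∫ₓ^{x₀} |ω₀² − V| ≤ K` for all `x ≤ x₀`. Then `u` vanishes identically. (Printed for
`𝕜 = ℂ` on the `r*`-line; the proof is the printed `y`-current argument with the current
`y(|u'|² + ω₀²|u|²)`, see the module docstring.) [cite: Costa2019, Lemma 4.1(2)] -/
theorem uniqueContinuation_atBot {u u' u'' : ℝ → 𝕜} {V : ℝ → ℝ} {ω₀ x₀ K : ℝ} (hω : ω₀ ≠ 0)
    (hu : ∀ x, HasDerivAt u (u' x) x) (hu' : ∀ x, HasDerivAt u' (u'' x) x)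
    (hode : ∀ x, u'' x + (V x : 𝕜) * u x = 0) (hV : Continuous V)
    (hint : ∀ x, x ≤ x₀ → ∫ t in x..x₀, |ω₀ ^ 2 - V t| ≤ K)
    (hbu : ∃ B, ∀ x, ‖u x‖ ≤ B) (hbu' : ∃ B, ∀ x, ‖u' x‖ ≤ B)
    (h0 : Tendsto u atBot (𝓝 0)) (h0' : Tendsto u' atBot (𝓝 0)) : ∀ x, u x = 0 := by
  obtain ⟨B, hB⟩ := hbu
  obtain ⟨B', hB'⟩ := hbu'
  have hucont : Continuous u := continuous_iff_continuousAt.2 fun x => (hu x).continuousAt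
  have hu'cont : Continuous u' := continuous_iff_continuousAt.2 fun x => (hu' x).continuousAt
  -- the weight `ζ = |V̂| + sigmoid`
  set Vh : ℝ → ℝ := fun x => ω₀ ^ 2 - V x with hVh
  have hVhc : Continuous Vh := continuous_const.sub hV
  set ζ : ℝ → ℝ := fun x => |Vh x| + Real.exp (x - x₀) / (1 + Real.exp (x - x₀)) with hζ
  have hsigc : Continuous fun x : ℝ => Real.exp (x - x₀) / (1 + Real.exp (x - x₀)) :=
    continuous_sigmoid.comp (continuous_id.sub continuous_const)
  have hζc : Continuous ζ := hVhc.abs.add hsigc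
  have hζpos : ∀ x, 0 < ζ x := fun x => add_pos_of_nonneg_of_pos (abs_nonneg _) (sigmoid_pos _)
  have hVhζ : ∀ x, |Vh x| ≤ ζ x := fun x => le_add_of_nonneg_right (sigmoid_pos _).le
  -- its primitive `Z` and the bounds `−(K+1) ≤ Z`, `Z x ≥ (x − x₀)/2` for `x ≥ x₀`
  set Z : ℝ → ℝ := fun x => ∫ t in x₀..x, ζ t with hZ
  have hZd : ∀ x, HasDerivAt Z (ζ x) x := fun x => (hζc.integral_hasStrictDerivAt x₀ x).hasDerivAt
  have hZc : Continuous Z := continuous_iff_continuousAt.2 fun x => (hZd x).continuousAt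
  have hK0 : 0 ≤ K := by simpa using hint x₀ le_rfl
  have hZlow : ∀ x, -(K + 1) ≤ Z x := by
    intro x
    rcases le_or_gt x₀ x with hx | hx
    · have : 0 ≤ Z x := intervalIntegral.integral_nonneg hx fun t _ => (hζpos t).le
      linarith
    · have hZx : Z x = -∫ t in x..x₀, ζ t := integral_symm _ _
      have hsplit : (∫ t in x..x₀, ζ t) =
          (∫ t in x..x₀, |Vh t|) + ∫ t in x..x₀, Real.exp (t - x₀) / (1 + Real.exp (t - x₀)) :=
        integral_add (hVhc.abs.intervalIntegrable _ _) (hsigc.intervalIntegrable _ _)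
      have h1 : (∫ t in x..x₀, |Vh t|) ≤ K := hint x hx.le
      have h2 := integral_sigmoid_le_one hx.le
      linarith
  have hZhigh : ∀ x, x₀ ≤ x → (x - x₀) / 2 ≤ Z x := by
    intro x hx
    have h : (∫ _ in x₀..x, (1 / 2 : ℝ)) ≤ Z x :=
      integral_mono_on hx (continuous_const.intervalIntegrable _ _) (hζc.intervalIntegrable _ _)
        fun t ht =>
          (half_le_sigmoid (sub_nonneg.2 ht.1)).trans (le_add_of_nonneg_left (abs_nonneg _))
    have h' : (∫ _ in x₀..x, (1 / 2 : ℝ)) = (x - x₀) / 2 := by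
      rw [intervalIntegral.integral_const, smul_eq_mul]; ring
    linarith
  -- the weight `y = −exp(−C Z)`, `C = 2/|ω₀|`
  set C : ℝ := 2 / |ω₀| with hC
  have hω' : 0 < |ω₀| := abs_pos.2 hω
  have hCpos : 0 < C := by positivity
  set y : ℝ → ℝ := fun x => -Real.exp (-C * Z x) with hy
  set y' : ℝ → ℝ := fun x => C * ζ x * Real.exp (-C * Z x) with hy'
  have hyd : ∀ x, HasDerivAt y (y' x) x := by
    intro x
    have h1 : HasDerivAt (fun x => -C * Z x) (-C * ζ x) x := (hZd x).const_mul (-C)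
    exact h1.exp.fun_neg.congr_deriv (by simp only [hy']; ring)
  have hy'pos : ∀ x, 0 < y' x := fun x => by positivity
  have hy'c : Continuous y' :=
    (continuous_const.mul hζc).mul (Real.continuous_exp.comp (continuous_const.mul hZc))
  have hCne : C ≠ 0 := hCpos.ne'
  have hane : |ω₀| ≠ 0 := hω'.ne'
  have hyabs : ∀ x, |y x| = Real.exp (-C * Z x) := fun x => by
    simp only [hy, abs_neg, Real.abs_exp]
  set Y : ℝ := Real.exp (C * (K + 1)) with hY
  have hybdd : ∀ x, |y x| ≤ Y := fun x => by
    rw [hyabs]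
    exact Real.exp_le_exp.2 (by nlinarith [hZlow x, hCpos])
  have hyζ : ∀ x, |y x| * ζ x = y' x / C := fun x => by
    rw [hyabs, eq_div_iff hCne]; simp only [hy']; ring
  have hytop : Tendsto y atTop (𝓝 0) := by
    rw [tendsto_zero_iff_norm_tendsto_zero]
    have hg : Tendsto (fun x => Real.exp (-C * ((x - x₀) / 2))) atTop (𝓝 0) := by
      refine Real.tendsto_exp_atBot.comp ?_
      have h1 : Tendsto (fun x : ℝ => (x - x₀) / 2) atTop atTop := by
        refine Tendsto.atTop_div_const (by norm_num) ?_
        simpa [sub_eq_add_neg] using tendsto_atTop_add_const_right atTop (-x₀) tendsto_id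
      exact h1.const_mul_atTop_of_neg (by linarith)
    refine squeeze_zero' (Eventually.of_forall fun x => norm_nonneg _) ?_ hg
    filter_upwards [eventually_ge_atTop x₀] with x hx
    rw [Real.norm_eq_abs, hyabs]
    exact Real.exp_le_exp.2 (by nlinarith [hZhigh x hx, hCpos])
  -- the current `P = y S`, `S = |u'|² + ω₀²|u|²`, and its derivative `P' = y' S + T`
  set S : ℝ → ℝ := fun x => ‖u' x‖ ^ 2 + ω₀ ^ 2 * ‖u x‖ ^ 2 with hS
  set ip : ℝ → ℝ := fun x => RCLike.re (conj (u x) * u' x) with hip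
  set T : ℝ → ℝ := fun x => y x * (2 * Vh x * ip x) with hT
  set P : ℝ → ℝ := fun x => y x * S x with hP
  have hSc : Continuous S :=
    (hu'cont.norm.pow 2).add (continuous_const.mul (hucont.norm.pow 2))
  have hSnn : ∀ x, 0 ≤ S x := fun x => by positivity
  have hipc : Continuous ip := RCLike.continuous_re.comp (hucont.star.mul hu'cont)
  have hTc : Continuous T :=
    (continuous_iff_continuousAt.2 fun x => (hyd x).continuousAt).mul
      ((continuous_const.mul hVhc).mul hipc)
  have hSd : ∀ x, HasDerivAt S (2 * Vh x * ip x) x := by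
    intro x
    have h1 := Literature.Analysis.ODE.hasDerivAt_normSq (hu' x)
    have h2 := (Literature.Analysis.ODE.hasDerivAt_normSq (hu x)).const_mul (ω₀ ^ 2)
    have hu''x : u'' x = -((V x : 𝕜) * u x) := eq_neg_of_add_eq_zero_left (hode x)
    have h3 : RCLike.re (conj (u' x) * u'' x) = -(V x * ip x) := by
      rw [hu''x, mul_neg, map_neg, ← mul_assoc, mul_comm (conj (u' x)) (V x : 𝕜), mul_assoc,
        RCLike.re_ofReal_mul, re_conj_mul_swap]
    refine (h1.add h2).congr_deriv ?_
    rw [h3]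
    simp only [hVh, hip]
    ring
  have hPd : ∀ x, HasDerivAt P (y' x * S x + T x) x := fun x => (hyd x).mul (hSd x)
  -- limits of `P` at `±∞`
  have hS0 : Tendsto S atBot (𝓝 0) := by
    have h1 : Tendsto (fun x => ‖u' x‖ ^ 2) atBot (𝓝 0) := by
      simpa using (tendsto_zero_iff_norm_tendsto_zero.mp h0').pow 2
    have h2 : Tendsto (fun x => ω₀ ^ 2 * ‖u x‖ ^ 2) atBot (𝓝 0) := by
      simpa using ((tendsto_zero_iff_norm_tendsto_zero.mp h0).pow 2).const_mul (ω₀ ^ 2)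
    simpa [hS] using h1.add h2
  have hPbot : Tendsto P atBot (𝓝 0) := by
    refine squeeze_zero_norm (fun x => ?_) (by simpa using hS0.const_mul Y)
    change ‖y x * S x‖ ≤ Y * S x
    rw [Real.norm_eq_abs, abs_mul, abs_of_nonneg (hSnn x)]
    exact mul_le_mul_of_nonneg_right (hybdd x) (hSnn x)
  have hSbdd : ∀ x, S x ≤ B' ^ 2 + ω₀ ^ 2 * B ^ 2 := fun x => by
    have h1 : ‖u' x‖ ^ 2 ≤ B' ^ 2 := pow_le_pow_left₀ (norm_nonneg _) (hB' x) 2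
    have h2 : ‖u x‖ ^ 2 ≤ B ^ 2 := pow_le_pow_left₀ (norm_nonneg _) (hB x) 2
    simp only [hS]
    nlinarith [sq_nonneg ω₀]
  have hPtop : Tendsto P atTop (𝓝 0) := by
    have hlim : Tendsto (fun x => ‖y x‖ * (B' ^ 2 + ω₀ ^ 2 * B ^ 2)) atTop (𝓝 0) := by
      simpa using (tendsto_zero_iff_norm_tendsto_zero.mp hytop).mul_const (B' ^ 2 + ω₀ ^ 2 * B ^ 2)
    refine squeeze_zero_norm (fun x => ?_) hlim
    change ‖y x * S x‖ ≤ ‖y x‖ * (B' ^ 2 + ω₀ ^ 2 * B ^ 2)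
    rw [Real.norm_eq_abs, abs_mul, abs_of_nonneg (hSnn x), Real.norm_eq_abs]
    exact mul_le_mul_of_nonneg_left (hSbdd x) (abs_nonneg _)
  -- integrability of `P' = y' S + T`
  have hy'int : Integrable y' := by
    refine integrable_of_intervalIntegral_norm_bounded (2 * Y) (l := atTop)
      (a := fun n : ℕ => -(n : ℝ)) (b := fun n : ℕ => (n : ℝ)) (fun n => ?_)
      (tendsto_neg_atTop_atBot.comp tendsto_natCast_atTop_atTop) tendsto_natCast_atTop_atTop ?_
    · exact (hy'c.integrableOn_Icc).mono_set Ioc_subset_Icc_self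
    · filter_upwards with n
      calc ∫ x in (-(n : ℝ))..n, ‖y' x‖ = ∫ x in (-(n : ℝ))..n, y' x :=
            integral_congr fun x _ => by rw [Real.norm_eq_abs, abs_of_pos (hy'pos x)]
        _ = y n - y (-n) := integral_eq_sub_of_hasDerivAt (fun x _ => hyd x)
            (hy'c.intervalIntegrable _ _)
        _ ≤ |y n| + |y (-n)| := by linarith [le_abs_self (y n), neg_abs_le (y (-(n : ℝ)))]
        _ ≤ 2 * Y := by linarith [hybdd n, hybdd (-n)]
  have hy'S : Integrable fun x => y' x * S x :=
    hy'int.mul_bdd (c := B' ^ 2 + ω₀ ^ 2 * B ^ 2) hSc.aestronglyMeasurable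
      (ae_of_all _ fun x => by
        rw [Real.norm_eq_abs, abs_of_nonneg (hSnn x)]; exact hSbdd x)
  -- the absorption inequality `|T| ≤ y' S / 2`
  have hTle : ∀ x, |T x| ≤ y' x * S x / 2 := by
    intro x
    have hamgm : 2 * (‖u x‖ * ‖u' x‖) ≤ S x / |ω₀| := by
      rw [le_div_iff₀ hω']
      show 2 * (‖u x‖ * ‖u' x‖) * |ω₀| ≤ ‖u' x‖ ^ 2 + ω₀ ^ 2 * ‖u x‖ ^ 2
      nlinarith [sq_nonneg (|ω₀| * ‖u x‖ - ‖u' x‖), sq_abs ω₀, norm_nonneg (u x),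
        norm_nonneg (u' x)]
    calc |T x| = |y x| * (2 * |Vh x| * |ip x|) := by
          simp only [hT, abs_mul, abs_two]
      _ ≤ |y x| * (2 * ζ x * (‖u x‖ * ‖u' x‖)) := by
          refine mul_le_mul_of_nonneg_left ?_ (abs_nonneg _)
          exact mul_le_mul (by linarith [hVhζ x]) (abs_re_conj_mul_le _ _) (abs_nonneg _)
            (by linarith [(hζpos x).le])
      _ = y' x / C * (2 * (‖u x‖ * ‖u' x‖)) := by rw [← hyζ x]; ring
      _ ≤ y' x / C * (S x / |ω₀|) :=
          mul_le_mul_of_nonneg_left hamgm (div_nonneg (hy'pos x).le hCpos.le)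
      _ = y' x * S x / 2 := by
          simp only [hC]
          field_simp
  have hTint : Integrable T := by
    refine (hy'S.div_const 2).mono' hTc.aestronglyMeasurable (ae_of_all _ fun x => ?_)
    rw [Real.norm_eq_abs]
    exact hTle x
  -- `∫ P' = P(+∞) − P(−∞) = 0`, absorb, conclude `y' S ≡ 0`
  have hInt0 : ∫ x, (y' x * S x + T x) = 0 := by
    simpa using integral_of_hasDerivAt_of_tendsto hPd (hy'S.add hTint) hPbot hPtop
  have hle : ∫ x, y' x * S x ≤ (∫ x, y' x * S x) / 2 := by
    have h1 : ∫ x, y' x * S x = -∫ x, T x := by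
      rw [integral_add hy'S hTint] at hInt0; linarith
    have h2 : -∫ x, T x ≤ ∫ x, y' x * S x / 2 := by
      rw [← MeasureTheory.integral_neg]
      exact integral_mono hTint.neg (hy'S.div_const 2) fun x => by
        show -T x ≤ y' x * S x / 2
        linarith [hTle x, neg_le_abs (T x)]
    have h3 : ∫ x, y' x * S x / 2 = (∫ x, y' x * S x) / 2 := integral_div 2 _
    linarith
  have hnn : 0 ≤ ∫ x, y' x * S x := integral_nonneg fun x => mul_nonneg (hy'pos x).le (hSnn x)
  have hzero : ∫ x, y' x * S x = 0 := by linarith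
  have hae : (fun x => y' x * S x) =ᵐ[volume] 0 :=
    (integral_eq_zero_iff_of_nonneg (fun x => mul_nonneg (hy'pos x).le (hSnn x)) hy'S).mp hzero
  have hfun : (fun x => y' x * S x) = 0 :=
    ((hy'c.mul hSc).ae_eq_iff_eq volume continuous_const).mp hae
  intro x
  have hx : y' x * S x = 0 := congrFun hfun x
  have hSx : S x = 0 := (mul_eq_zero.mp hx).resolve_left (hy'pos x).ne'
  have h2 : ω₀ ^ 2 * ‖u x‖ ^ 2 = 0 := by
    simp only [hS] at hSx
    nlinarith [sq_nonneg ‖u' x‖, mul_nonneg (sq_nonneg ω₀) (sq_nonneg ‖u x‖)]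
  rcases mul_eq_zero.mp h2 with h | h
  · exact absurd (pow_eq_zero_iff two_ne_zero |>.mp h) hω
  · exact norm_eq_zero.mp (pow_eq_zero_iff two_ne_zero |>.mp h)

/-- **Unique continuation lemma, mirrored** (Teixeira da Costa 2020, Lemma 4.1, statement (1) =
Shlapentokh-Rothman 2015): the same conclusion when `u, u' → 0` at `+∞` and
`∫_{x₀}^{x} |ω₀² − V| ≤ K` for all `x ≥ x₀` (`V(+∞) = ω₀² ≠ 0` at an integrable rate).
Reduced to `uniqueContinuation_atBot` by the reflection `x ↦ −x`.
[cite: Costa2019, Lemma 4.1(1)] -/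
theorem uniqueContinuation_atTop {u u' u'' : ℝ → 𝕜} {V : ℝ → ℝ} {ω₀ x₀ K : ℝ} (hω : ω₀ ≠ 0)
    (hu : ∀ x, HasDerivAt u (u' x) x) (hu' : ∀ x, HasDerivAt u' (u'' x) x)
    (hode : ∀ x, u'' x + (V x : 𝕜) * u x = 0) (hV : Continuous V)
    (hint : ∀ x, x₀ ≤ x → ∫ t in x₀..x, |ω₀ ^ 2 - V t| ≤ K)
    (hbu : ∃ B, ∀ x, ‖u x‖ ≤ B) (hbu' : ∃ B, ∀ x, ‖u' x‖ ≤ B)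
    (h0 : Tendsto u atTop (𝓝 0)) (h0' : Tendsto u' atTop (𝓝 0)) : ∀ x, u x = 0 := by
  -- reflect: `ǔ x = u(−x)`, `ǔ' x = −u'(−x)`, `ǔ'' x = u''(−x)`, `V̌ x = V(−x)`
  have hn : ∀ x : ℝ, HasDerivAt (fun x : ℝ => -x) (-1) x := fun x => hasDerivAt_neg x
  have hcu : ∀ x, HasDerivAt (fun x => u (-x)) (-u' (-x)) x := fun x => by
    simpa [Function.comp_def] using (hu (-x)).scomp x (hn x)
  have hcu' : ∀ x, HasDerivAt (fun x => -u' (-x)) (u'' (-x)) x := fun x => by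
    simpa [Function.comp_def] using ((hu' (-x)).scomp x (hn x)).fun_neg
  obtain ⟨B, hB⟩ := hbu
  obtain ⟨B', hB'⟩ := hbu'
  have h := uniqueContinuation_atBot (u := fun x => u (-x)) (u' := fun x => -u' (-x))
    (u'' := fun x => u'' (-x)) (V := fun x => V (-x)) (x₀ := -x₀) (K := K) hω hcu hcu'
    (fun x => by simpa using hode (-x)) (hV.comp continuous_neg)
    (fun x hx => by
      have h1 := hint (-x) (by linarith)
      have h2 : (∫ t in x..(-x₀), |ω₀ ^ 2 - V (-t)|) = ∫ t in x₀..(-x), |ω₀ ^ 2 - V t| := by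
        simpa using
          intervalIntegral.integral_comp_neg (a := x) (b := -x₀) (fun t => |ω₀ ^ 2 - V t|)
      simpa [h2] using h1)
    ⟨B, fun x => hB (-x)⟩ ⟨B', fun x => by simpa using hB' (-x)⟩
    (h0.comp tendsto_neg_atBot_atTop)
    (by simpa [Function.comp_def] using (h0'.comp tendsto_neg_atBot_atTop).neg)
  intro x
  simpa using h (-x)

/-! ### §4.2 for `|a| < M` and real `ω`: the `T`-current argument on the transformed equation

The printed deduction (TdC §4.2, case `ω ∈ ℝ ∖ {0}`, `|a| < M`): for the transformed function `ũ`
of Prop. 3.8 the potential `Ṽ` is real, so `Q̃ᵀ = Im(ũ' \overline{ω ũ})` is conserved; the boundary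
behaviour `ũ' − iωũ → 0` at `+∞` and `ũ' + iω((r₊−r₋)/r₊)ũ → 0` at `−∞` (Prop. 3.8 (4)) turns
`0 = Q̃ᵀ(−∞) − Q̃ᵀ(+∞)` into a sum of non-negative multiples of `|ũ(±∞)|²`, so `ũ, ũ' → 0` at both
ends, and Lemma 4.1 gives `ũ ≡ 0`. Below this is made rigorous WITHOUT presupposing that
`|ũ|(±∞)` exist: the constancy of `Q` and the boundary relations give
`ω²|ũ|² → Q₀` at `+∞` and `ωω₀|ũ|² → −Q₀` at `−∞` (`ω₀ := ω(r₊−r₋)/r₊`, `ωω₀ > 0`), hence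
`Q₀ = 0`. -/

/-- `Im(i c r) = c r` for real `c, r`. [folklore] -/
theorem im_I_mul_ofReal_mul (c r : ℝ) : (Complex.I * c * (r : ℂ)).im = c * r := by
  simp [Complex.mul_im]

/-- **Conservation of the `T`-current** (TdC (eq. T-current-tilde)): for a `C²` solution of
`v'' + W v = 0` with REAL `W`, `Q = ω · Im(v' \bar v)` has derivative `0`.
[cite: Costa2019, §4.2, (T-current)] -/
theorem hasDerivAt_tCurrent {v v' v'' : ℝ → ℂ} {W : ℝ → ℝ} (ω : ℝ)
    (hv : ∀ x, HasDerivAt v (v' x) x) (hv' : ∀ x, HasDerivAt v' (v'' x) x)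
    (hode : ∀ x, v'' x + (W x : ℂ) * v x = 0) (x : ℝ) :
    HasDerivAt (fun x => ω * (v' x * conj (v x)).im) 0 x := by
  have hc : HasDerivAt (fun x => conj (v x)) (conj (v' x)) x := by
    simpa only [starRingEnd_apply] using (hv x).star
  have hm := (hv' x).mul hc
  have him : HasDerivAt (fun x => (v' x * conj (v x)).im)
      ((v'' x * conj (v x) + v' x * conj (v' x)).im) x := by
    simpa [Function.comp_def] using Complex.imCLM.hasFDerivAt.comp_hasDerivAt x hm
  have hzero : (v'' x * conj (v x) + v' x * conj (v' x)).im = 0 := by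
    have hv''x : v'' x = -((W x : ℂ) * v x) := eq_neg_of_add_eq_zero_left (hode x)
    rw [hv''x, neg_mul, mul_assoc, Complex.mul_conj, Complex.mul_conj]
    simp [Complex.mul_im]
  simpa [hzero] using him.const_mul ω

/-- **TdC §4.2 for `|a| < M`, `ω` real (abstract form): the transformed function vanishes.**
Let `v : ℝ → ℂ` be `C²` with `v'' + W v = 0`, `W` real and continuous with
`∫ₓ^{x₀} |ω₀² − W| ≤ K` for `x ≤ x₀` (`W(−∞) = ω₀²` at an integrable rate), `v`, `v'` bounded,
and with the boundary behaviour `v' + iω₀ v → 0` at `−∞`, `v' − iω v → 0` at `+∞`, where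
`ω ω₀ > 0` (in the source `ω₀ = ω(r₊ − r₋)/r₊`: Prop. 3.8 (2)–(4) and Remark 3.9 (iv)–(v)). Then
`v ≡ 0`: the conserved current `Q = ω Im(v' \bar v)` satisfies `ω²|v|² → Q(0)` at `+∞` and
`ωω₀|v|² → −Q(0)` at `−∞`, so `Q(0) = 0`, `v, v' → 0` at `−∞`, and
`uniqueContinuation_atBot` applies. [cite: Costa2019, §4.2 (proof of Theorem 4.1 for s ≤ 0,
case ω ∈ ℝ∖{0}, |a| < M)] -/
theorem transformedSolution_eq_zero {v v' v'' : ℝ → ℂ} {W : ℝ → ℝ} {ω ω₀ x₀ K : ℝ}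
    (hωω₀ : 0 < ω * ω₀)
    (hv : ∀ x, HasDerivAt v (v' x) x) (hv' : ∀ x, HasDerivAt v' (v'' x) x)
    (hode : ∀ x, v'' x + (W x : ℂ) * v x = 0) (hW : Continuous W)
    (hint : ∀ x, x ≤ x₀ → ∫ t in x..x₀, |ω₀ ^ 2 - W t| ≤ K)
    (hbv : ∃ B, ∀ x, ‖v x‖ ≤ B) (hbv' : ∃ B, ∀ x, ‖v' x‖ ≤ B)
    (hbot : Tendsto (fun x => v' x + Complex.I * ω₀ * v x) atBot (𝓝 0))
    (htop : Tendsto (fun x => v' x - Complex.I * ω * v x) atTop (𝓝 0)) : ∀ x, v x = 0 := by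
  have hω : ω ≠ 0 := fun h => by simp [h] at hωω₀
  have hω₀ : ω₀ ≠ 0 := fun h => by simp [h] at hωω₀
  obtain ⟨B, hB⟩ := hbv
  -- the conserved current `Q`
  set Q : ℝ → ℝ := fun x => ω * (v' x * conj (v x)).im with hQ
  have hQd : ∀ x, HasDerivAt Q 0 x := fun x => hasDerivAt_tCurrent ω hv hv' hode x
  have hQc : ∀ x, Q x = Q 0 := fun x =>
    is_const_of_deriv_eq_zero (fun x => (hQd x).differentiableAt) (fun x => (hQd x).deriv) x 0
  -- `Q = ω c |v|² + ω Im((v' − i c v) \bar v)` for every real `c`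
  have key : ∀ c x : ℝ,
      Q x = ω * c * ‖v x‖ ^ 2 + ω * ((v' x - Complex.I * c * v x) * conj (v x)).im := by
    intro c x
    have h1 : v' x * conj (v x) =
        (v' x - Complex.I * c * v x) * conj (v x) + Complex.I * c * (v x * conj (v x)) := by ring
    simp only [hQ]
    rw [h1, Complex.mul_conj, Complex.add_im, Complex.normSq_eq_norm_sq, im_I_mul_ofReal_mul]
    ring
  -- the error terms `ω Im(e \bar v)` tend to zero whenever `e → 0` (`v` bounded)
  have herr : ∀ {l : Filter ℝ} {e : ℝ → ℂ}, Tendsto e l (𝓝 0) →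
      Tendsto (fun x => ω * (e x * conj (v x)).im) l (𝓝 0) := by
    intro l e he
    have h1 : Tendsto (fun x => ‖e x‖ * (|ω| * B)) l (𝓝 0) := by
      simpa using (tendsto_zero_iff_norm_tendsto_zero.mp he).mul_const (|ω| * B)
    refine squeeze_zero_norm (fun x => ?_) h1
    rw [Real.norm_eq_abs, abs_mul]
    have h2 : |(e x * conj (v x)).im| ≤ ‖e x‖ * ‖v x‖ :=
      (Complex.abs_im_le_norm _).trans_eq (by rw [norm_mul, Complex.norm_conj])
    calc |ω| * |(e x * conj (v x)).im| ≤ |ω| * (‖e x‖ * ‖v x‖) :=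
          mul_le_mul_of_nonneg_left h2 (abs_nonneg ω)
      _ ≤ |ω| * (‖e x‖ * B) :=
          mul_le_mul_of_nonneg_left (mul_le_mul_of_nonneg_left (hB x) (norm_nonneg _))
            (abs_nonneg ω)
      _ = ‖e x‖ * (|ω| * B) := by ring
  -- at `+∞`: `ω²|v|² → Q 0`, so `Q 0 ≥ 0`
  have htopQ : Tendsto (fun x => ω * ω * ‖v x‖ ^ 2) atTop (𝓝 (Q 0)) := by
    have h2 : Tendsto (fun x => Q x - ω * ((v' x - Complex.I * ω * v x) * conj (v x)).im) atTop
        (𝓝 (Q 0 - 0)) :=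
      (tendsto_const_nhds.congr fun x => (hQc x).symm).sub (herr htop)
    rw [sub_zero] at h2
    refine h2.congr fun x => ?_
    rw [key ω x]
    ring
  have hQ0_nonneg : 0 ≤ Q 0 :=
    ge_of_tendsto htopQ (Eventually.of_forall fun x =>
      show 0 ≤ ω * ω * ‖v x‖ ^ 2 from mul_nonneg (mul_self_nonneg ω) (sq_nonneg _))
  -- at `−∞`: `ω(−ω₀)|v|² → Q 0`, so `Q 0 ≤ 0`
  have hbot' : Tendsto (fun x => v' x - Complex.I * ((-ω₀ : ℝ) : ℂ) * v x) atBot (𝓝 0) := by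
    refine hbot.congr fun x => ?_
    push_cast
    ring
  have hbotQ : Tendsto (fun x => ω * (-ω₀) * ‖v x‖ ^ 2) atBot (𝓝 (Q 0)) := by
    have h2 : Tendsto
        (fun x => Q x - ω * ((v' x - Complex.I * ((-ω₀ : ℝ) : ℂ) * v x) * conj (v x)).im) atBot
        (𝓝 (Q 0 - 0)) :=
      (tendsto_const_nhds.congr fun x => (hQc x).symm).sub (herr hbot')
    rw [sub_zero] at h2
    refine h2.congr fun x => ?_
    rw [key (-ω₀) x]
    ring
  have hQ0_nonpos : Q 0 ≤ 0 :=
    le_of_tendsto hbotQ (Eventually.of_forall fun x =>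
      show ω * (-ω₀) * ‖v x‖ ^ 2 ≤ 0 by nlinarith [sq_nonneg ‖v x‖])
  have hQ0 : Q 0 = 0 := le_antisymm hQ0_nonpos hQ0_nonneg
  -- hence `v, v' → 0` at `−∞`
  have hnorm2 : Tendsto (fun x => ‖v x‖ ^ 2) atBot (𝓝 0) := by
    have hc : ω * (-ω₀) ≠ 0 := mul_ne_zero hω (neg_ne_zero.2 hω₀)
    have h := hbotQ.div_const (ω * (-ω₀))
    rw [hQ0, zero_div] at h
    refine h.congr fun x => ?_
    field_simp
  have hnorm : Tendsto (fun x => ‖v x‖) atBot (𝓝 0) := by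
    simpa [Real.sqrt_sq (norm_nonneg _)] using hnorm2.sqrt
  have hv0 : Tendsto v atBot (𝓝 0) := tendsto_zero_iff_norm_tendsto_zero.mpr hnorm
  have hv'0 : Tendsto v' atBot (𝓝 0) := by
    simpa using hbot.sub (hv0.const_mul (Complex.I * ω₀))
  exact uniqueContinuation_atBot (𝕜 := ℂ) hω₀ hv hv' hode hW hint ⟨B, hB⟩ hbv' hv0 hv'0

/-! ### Regularity of classical solutions of the radial ODE (used throughout §3.2)

TdC treats outgoing solutions as smooth on `(r₊, ∞)` ("classical solutions", Def. 2.3, and the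
repeated integrations by parts of Lemma 3.10 differentiate `g` up to `3 − 2s` times). For the
vendored notion (`Kerr.IsRadialTeukolskySolution`: `C²` and the equation pointwise) this is the
standard bootstrap: `R'' = p R' + q R` with `p = −2(s+1)(r−M)/Δ`, `q = −V/Δ` smooth on
`(r₊, ∞)` (`Δ > 0` there), so `R ∈ C^∞(r₊, ∞)`
(`Literature.Analysis.ODE.contDiffOn_of_solution`, Hartman Ch. V Cor. 4.1). -/

/-- **Classical solutions of the radial Teukolsky ODE are smooth on `(r₊, ∞)`** (`|a| ≤ M`).
[cite: Costa2019, §2.2.3 (classical solutions) with Hartman2002, Ch. V Cor. 4.1] -/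
theorem contDiffOn_of_isRadialTeukolskySolution {M a s ω m lam : ℝ} (ha : |a| ≤ M) {R : ℝ → ℂ}
    (h : IsRadialTeukolskySolution M a s ω m lam R) :
    ContDiffOn ℝ ((⊤ : ℕ∞) : WithTop ℕ∞) R (Ioi (rPlus M a)) := by
  obtain ⟨R', R'', hR⟩ := h
  -- the potential `V` (coefficient of `R`) and the normalised coefficients `p`, `q`
  set V : ℝ → ℂ := fun r =>
    (((radialK a ω m r ^ 2 : ℝ) : ℂ) -
          2 * Complex.I * (s : ℂ) * ((r - M : ℝ) : ℂ) * (radialK a ω m r : ℂ)) / (delta M a r : ℂ) +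
        4 * Complex.I * (s : ℂ) * (ω : ℂ) * (r : ℂ) - (lam : ℂ) - ((a ^ 2 * ω ^ 2 : ℝ) : ℂ) +
      ((2 * a * m * ω : ℝ) : ℂ) with hV
  set p : ℝ → ℂ := fun r => -(2 * ((s + 1 : ℝ) : ℂ) * ((r - M : ℝ) : ℂ)) / (delta M a r : ℂ)
    with hp
  set q : ℝ → ℂ := fun r => -V r / (delta M a r : ℂ) with hq
  have hΔ0 : ∀ r ∈ Ioi (rPlus M a), (delta M a r : ℂ) ≠ 0 := fun r hr => by
    exact_mod_cast (delta_pos ha hr).ne'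
  -- smoothness of the coefficients on `(r₊, ∞)`
  have hc : ∀ {f : ℝ → ℝ}, ContDiff ℝ ((⊤ : ℕ∞) : WithTop ℕ∞) f →
      ContDiff ℝ ((⊤ : ℕ∞) : WithTop ℕ∞) (fun r => (f r : ℂ)) := fun hf =>
    Complex.ofRealCLM.contDiff.comp hf
  have hΔ : ContDiff ℝ ((⊤ : ℕ∞) : WithTop ℕ∞) (fun r => (delta M a r : ℂ)) :=
    hc (show ContDiff ℝ ((⊤ : ℕ∞) : WithTop ℕ∞) (fun r => r ^ 2 - 2 * M * r + a ^ 2) from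
      ((contDiff_id.pow 2).sub (contDiff_const.mul contDiff_id)).add contDiff_const)
  have hK1 : ContDiff ℝ ((⊤ : ℕ∞) : WithTop ℕ∞) (radialK a ω m) :=
    show ContDiff ℝ ((⊤ : ℕ∞) : WithTop ℕ∞) (fun r => ω * (r ^ 2 + a ^ 2) - a * m) from
      (contDiff_const.mul ((contDiff_id.pow 2).add contDiff_const)).sub contDiff_const
  have hK : ContDiff ℝ ((⊤ : ℕ∞) : WithTop ℕ∞) (fun r => (radialK a ω m r : ℂ)) := hc hK1
  have hK2 : ContDiff ℝ ((⊤ : ℕ∞) : WithTop ℕ∞) (fun r => ((radialK a ω m r ^ 2 : ℝ) : ℂ)) :=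
    hc (hK1.pow 2)
  have hrM : ContDiff ℝ ((⊤ : ℕ∞) : WithTop ℕ∞) (fun r => ((r - M : ℝ) : ℂ)) :=
    hc (contDiff_id.sub contDiff_const)
  have hr : ContDiff ℝ ((⊤ : ℕ∞) : WithTop ℕ∞) (fun r : ℝ => (r : ℂ)) := Complex.ofRealCLM.contDiff
  have hdiv : ∀ {f : ℝ → ℂ}, ContDiffOn ℝ ((⊤ : ℕ∞) : WithTop ℕ∞) f (Ioi (rPlus M a)) →
      ContDiffOn ℝ ((⊤ : ℕ∞) : WithTop ℕ∞) (fun r => f r / (delta M a r : ℂ))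
        (Ioi (rPlus M a)) :=
    fun hf => by
      have h := hf.mul (hΔ.contDiffOn.inv hΔ0)
      simp only [Pi.inv_apply] at h
      simpa only [div_eq_mul_inv] using h
  have hVs : ContDiffOn ℝ ((⊤ : ℕ∞) : WithTop ℕ∞) V (Ioi (rPlus M a)) := by
    refine ContDiffOn.add (ContDiffOn.sub (ContDiffOn.sub (ContDiffOn.add
      (hdiv ?_) ?_) contDiffOn_const) contDiffOn_const) contDiffOn_const
    · exact (hK2.sub ((contDiff_const.mul hrM).mul hK)).contDiffOn
    · exact (contDiff_const.mul hr).contDiffOn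
  have hps : ContDiffOn ℝ ((⊤ : ℕ∞) : WithTop ℕ∞) p (Ioi (rPlus M a)) :=
    hdiv (contDiff_const.mul hrM).neg.contDiffOn
  have hqs : ContDiffOn ℝ ((⊤ : ℕ∞) : WithTop ℕ∞) q (Ioi (rPlus M a)) := hdiv hVs.neg
  -- the equation in normal form `R'' = p R' + q R`
  have hsol : ∀ t ∈ Ioi (rPlus M a),
      HasDerivAt R (R' t) t ∧ HasDerivAt R' (p t * R' t + q t * R t) t := by
    intro t ht
    obtain ⟨h1, h2, hode⟩ := hR t ht
    have hΔt := hΔ0 t ht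
    have h3 : (delta M a t : ℂ) * R'' t = -(2 * ((s + 1 : ℝ) : ℂ) * ((t - M : ℝ) : ℂ) * R' t +
        V t * R t) := by
      simp only [hV]
      linear_combination hode
    have h4 : R'' t = p t * R' t + q t * R t := by
      simp only [hp, hq]
      field_simp
      linear_combination h3
    exact ⟨h1, h4 ▸ h2⟩
  exact (Literature.Analysis.ODE.contDiffOn_of_solution isOpen_Ioi hps hqs hsol).1

/-! ### The Lagrange identity behind Lemma 3.13 (self-adjointness of `𝒯_r` for the weight
`(r−r₋)^{2η−s}(r−r₊)^{2ξ−s}e^{2γr}`), in abstract differential form -/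

/-- **Lagrange identity** (TdC Lemma 3.13, differential form, for an arbitrary operator
`T = D ∂² + P ∂ + Q` with a symmetrising weight). If `w' = w χ` and `D χ + D' = P` (i.e.
`(wD)' = wP`), then for `C²` functions `f`, `h`:
`d/dr [ w D (h f' − f h') ] = w (h · Tf − f · Th)`. Integrated over `[A₁, A₂]` this is the
printed `∫ (h 𝒯_r f − f 𝒯_r h) w dr = [(h f' − f h') Δ w]_{A₁}^{A₂}` for TdC's
`w = (r−r₋)^{2η−s}(r−r₊)^{2ξ−s}e^{2γr}`, `D = Δ`. [cite: Costa2019, Lemma 3.13] -/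
theorem lagrange_identity {D D' P Q w χ f f₁ f₂ h h₁ h₂ : ℝ → ℂ} {r : ℝ}
    (hw : HasDerivAt w (w r * χ r) r) (hD : HasDerivAt D (D' r) r)
    (hPχ : D r * χ r + D' r = P r)
    (hf : HasDerivAt f (f₁ r) r) (hf₁ : HasDerivAt f₁ (f₂ r) r)
    (hh : HasDerivAt h (h₁ r) r) (hh₁ : HasDerivAt h₁ (h₂ r) r) :
    HasDerivAt (fun x => w x * D x * (h x * f₁ x - f x * h₁ x))
      (w r * (h r * (D r * f₂ r + P r * f₁ r + Q r * f r) -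
        f r * (D r * h₂ r + P r * h₁ r + Q r * h r))) r := by
  have hW : HasDerivAt (fun x => h x * f₁ x - f x * h₁ x) (h r * f₂ r - f r * h₂ r) r :=
    ((hh.mul hf₁).sub (hf.mul hh₁)).congr_deriv (by ring)
  refine ((hw.mul hD).mul hW).congr_deriv ?_
  simp only [Pi.mul_apply]
  rw [← hPχ]
  ring

/-! ### Asymptotic toolkit, I: Landau's inequality on an interval

Used (in the sessions to come) to convert the outgoing expansion of `R` at infinity
(`Kerr.IsOutgoingAtInfinity`, a statement about `R` only) into bounds for `R'`, `R''`, … via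
the radial ODE — the derivative bounds behind the integrations by parts of TdC Lemma 3.10. -/

/-- **Landau's inequality on an interval.** If `f` is `C²` on `[x, x + h]` (`h > 0`) with
`‖f‖ ≤ A` and `‖f''‖ ≤ B` there, then `‖f'(x)‖ ≤ 2A/h + hB/2`
(from `h f'(x) = f(x+h) − f(x) − ∫ₓ^{x+h} (f'(t) − f'(x)) dt` and
`‖f'(t) − f'(x)‖ ≤ B (t − x)`). [folklore] -/
theorem norm_deriv_le_landau {E : Type*} [NormedAddCommGroup E] [NormedSpace ℝ E]
    [CompleteSpace E] {f f' f'' : ℝ → E} {x h A B : ℝ} (hh : 0 < h)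
    (hf : ∀ t ∈ Icc x (x + h), HasDerivAt f (f' t) t)
    (hf' : ∀ t ∈ Icc x (x + h), HasDerivAt f' (f'' t) t)
    (hf''c : ContinuousOn f'' (Icc x (x + h)))
    (hA : ∀ t ∈ Icc x (x + h), ‖f t‖ ≤ A) (hB : ∀ t ∈ Icc x (x + h), ‖f'' t‖ ≤ B) :
    ‖f' x‖ ≤ 2 * A / h + h * B / 2 := by
  have hxh : x ≤ x + h := by linarith
  have hf'c : ContinuousOn f' (Icc x (x + h)) := fun t ht =>
    (hf' t ht).continuousAt.continuousWithinAt
  have hB0 : 0 ≤ B := (norm_nonneg _).trans (hB x ⟨le_rfl, hxh⟩)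
  -- `f'(t) − f'(x) = ∫ₓᵗ f''`, hence `‖f'(t) − f'(x)‖ ≤ B (t − x)`
  have hinner : ∀ t ∈ Icc x (x + h), ‖f' t - f' x‖ ≤ B * (t - x) := by
    intro t ht
    have hsub : uIcc x t ⊆ Icc x (x + h) := by
      rw [uIcc_of_le ht.1]
      exact Icc_subset_Icc_right ht.2
    have h1 : ∫ u in x..t, f'' u = f' t - f' x :=
      integral_eq_sub_of_hasDerivAt (fun u hu => hf' u (hsub hu))
        ((hf''c.mono hsub).intervalIntegrable)
    rw [← h1]
    have h2 : ‖∫ u in x..t, f'' u‖ ≤ B * |t - x| :=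
      intervalIntegral.norm_integral_le_of_norm_le_const fun u hu => by
        refine hB u (hsub ?_)
        rw [uIcc_of_le ht.1]
        rw [uIoc_of_le ht.1] at hu
        exact Ioc_subset_Icc_self hu
    rwa [abs_of_nonneg (sub_nonneg.2 ht.1)] at h2
  -- `f(x+h) − f(x) = ∫ₓ^{x+h} f' = h • f'(x) + ∫ₓ^{x+h} (f' − f'(x))`
  have hIcc : uIcc x (x + h) = Icc x (x + h) := uIcc_of_le hxh
  have hf'i : IntervalIntegrable f' volume x (x + h) := (hf'c.mono hIcc.subset).intervalIntegrable
  have houter : ∫ t in x..(x + h), f' t = f (x + h) - f x :=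
    integral_eq_sub_of_hasDerivAt (fun t ht => hf t (hIcc ▸ ht)) hf'i
  have hsplit : (∫ t in x..(x + h), f' t) =
      h • f' x + ∫ t in x..(x + h), (f' t - f' x) := by
    rw [intervalIntegral.integral_sub hf'i intervalIntegrable_const,
      intervalIntegral.integral_const]
    simp only [add_sub_cancel_left]
    abel
  -- the remainder is at most `B h² / 2`
  have hrem : ‖∫ t in x..(x + h), (f' t - f' x)‖ ≤ B * h ^ 2 / 2 := by
    have h1 : ‖∫ t in x..(x + h), (f' t - f' x)‖ ≤ ∫ t in x..(x + h), B * (t - x) :=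
      intervalIntegral.norm_integral_le_of_norm_le hxh
        (Filter.Eventually.of_forall fun t ht => hinner t (Ioc_subset_Icc_self ht))
        ((continuous_const.mul (continuous_id.sub continuous_const)).intervalIntegrable _ _)
    have h2 : ∫ t in x..(x + h), B * (t - x) = B * h ^ 2 / 2 := by
      rw [intervalIntegral.integral_const_mul, intervalIntegral.integral_comp_sub_right
        (fun t => t) x, integral_id]
      simp only [sub_self, add_sub_cancel_left]
      ring
    rw [h2] at h1
    exact h1
  -- assemble
  have hkey : h • f' x = (f (x + h) - f x) - ∫ t in x..(x + h), (f' t - f' x) := by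
    rw [← houter, hsplit]
    abel
  have hnorm : h * ‖f' x‖ ≤ 2 * A + B * h ^ 2 / 2 := by
    have h1 : ‖h • f' x‖ = h * ‖f' x‖ := by rw [norm_smul, Real.norm_eq_abs, abs_of_pos hh]
    rw [← h1, hkey]
    calc ‖f (x + h) - f x - ∫ t in x..(x + h), (f' t - f' x)‖
        ≤ ‖f (x + h) - f x‖ + ‖∫ t in x..(x + h), (f' t - f' x)‖ := norm_sub_le _ _
      _ ≤ (‖f (x + h)‖ + ‖f x‖) + B * h ^ 2 / 2 := add_le_add (norm_sub_le _ _) hrem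
      _ ≤ (A + A) + B * h ^ 2 / 2 :=
          add_le_add (add_le_add (hA _ ⟨hxh, le_rfl⟩) (hA _ ⟨le_rfl, hxh⟩)) le_rfl
      _ = 2 * A + B * h ^ 2 / 2 := by ring
  rw [div_add_div _ _ hh.ne' two_ne_zero, le_div_iff₀ (by positivity)]
  nlinarith [hnorm, hh]

/-! ### Asymptotic toolkit, II: polynomial growth of solutions at the irregular singular point

For Whiting's transform at `Im z ≠ 0` (TdC §3.2.2, proof of Lemma 3.12: "This is clear at
`r = ∞`, due to the decay of `g` and `dg/dr`, together with the exponential decay brought in by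
either `Re ω y > 0` or `Im ω > 0`") one needs that an outgoing solution AND ITS DERIVATIVE grow at
most polynomially at infinity. For the derivative this is not part of the vendored hypothesis
`Kerr.IsOutgoingAtInfinity` (a statement about `R` alone); it follows from the equation: at the
irregular singular point `r = ∞` the normalised radial ODE reads `R'' = p R' + q R` with
`p = O(1/r)` and `q = −ω² + O(1/r)`, and the energy `‖R'‖² + ω²‖R‖²` then grows at most like a
power of `r`. -/

/-- **Polynomial growth at an oscillatory irregular singular point.** Let `R` solve
`R'' = p R' + q R` on `[X, ∞)` (`X ≥ 1`) with `‖p(r)‖ ≤ C₁/r` and `‖q(r) + ω²‖ ≤ C₂/r` there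
(`ω ≠ 0`). Then the energy `E = ‖R'‖² + ω²‖R‖²` satisfies `E(r) ≤ E(X) (r/X)^κ` for `r ≥ X`,
`κ = 2C₁ + C₂/|ω|` (from `E' = 2 Re(p)‖R'‖² + 2 Re((q + ω²) R̄' R) ≤ (κ/r) E`, i.e.
`(E r^{−κ})' ≤ 0`; cf. Olver, *Asymptotics and Special Functions*, Ch. 6 §1). [folklore] -/
theorem energy_le_mul_rpow_of_ode {R R' R'' p q : ℝ → ℂ} {ω X C₁ C₂ : ℝ} (hX : 1 ≤ X)
    (hω : ω ≠ 0)
    (hd : ∀ r, X ≤ r → HasDerivAt R (R' r) r ∧ HasDerivAt R' (R'' r) r ∧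
      R'' r = p r * R' r + q r * R r)
    (hp : ∀ r, X ≤ r → ‖p r‖ ≤ C₁ / r) (hq : ∀ r, X ≤ r → ‖q r + ω ^ 2‖ ≤ C₂ / r) {r : ℝ}
    (hr : X ≤ r) :
    ‖R' r‖ ^ 2 + ω ^ 2 * ‖R r‖ ^ 2 ≤
      (‖R' X‖ ^ 2 + ω ^ 2 * ‖R X‖ ^ 2) * (r / X) ^ (2 * C₁ + C₂ / |ω|) := by
  set κ : ℝ := 2 * C₁ + C₂ / |ω| with hκ
  have hX0 : 0 < X := one_pos.trans_le hX
  have hω' : 0 < |ω| := abs_pos.2 hω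
  have hC₁ : 0 ≤ C₁ := by
    have h := hp X le_rfl
    have : 0 ≤ C₁ / X := (norm_nonneg _).trans h
    exact (div_nonneg_iff.1 this).elim (fun h => h.1) fun h => absurd h.2 (not_le.2 hX0)
  have hC₂ : 0 ≤ C₂ := by
    have h := hq X le_rfl
    have : 0 ≤ C₂ / X := (norm_nonneg _).trans h
    exact (div_nonneg_iff.1 this).elim (fun h => h.1) fun h => absurd h.2 (not_le.2 hX0)
  -- the energy and its derivative
  set E : ℝ → ℝ := fun t => ‖R' t‖ ^ 2 + ω ^ 2 * ‖R t‖ ^ 2 with hE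
  set E' : ℝ → ℝ := fun t => 2 * RCLike.re (conj (R' t) * R'' t) +
    ω ^ 2 * (2 * RCLike.re (conj (R t) * R' t)) with hE'
  have hEd : ∀ t, X ≤ t → HasDerivAt E (E' t) t := by
    intro t ht
    obtain ⟨h1, h2, -⟩ := hd t ht
    exact (Literature.Analysis.ODE.hasDerivAt_normSq h2).add
      ((Literature.Analysis.ODE.hasDerivAt_normSq h1).const_mul (ω ^ 2))
  have hEnn : ∀ t, 0 ≤ E t := fun t => by positivity
  -- the differential inequality `E' ≤ (κ/t) E`
  have hineq : ∀ t, X ≤ t → E' t ≤ κ / t * E t := by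
    intro t ht
    obtain ⟨-, -, hode⟩ := hd t ht
    have ht0 : 0 < t := hX0.trans_le ht
    have hpt := hp t ht
    have hqt := hq t ht
    -- `E' = 2 re(p̄?)`: compute with the equation
    have hE't : E' t = 2 * RCLike.re (conj (R' t) * (p t * R' t)) +
        2 * RCLike.re (conj (R' t) * ((q t + ω ^ 2) * R t)) := by
      simp only [hE', hode]
      have h1 : conj (R' t) * (p t * R' t + q t * R t) =
          conj (R' t) * (p t * R' t) + conj (R' t) * ((q t + ω ^ 2) * R t) -
            (ω ^ 2 : ℂ) * (conj (R' t) * R t) := by ring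
      rw [h1, map_sub, map_add]
      have h2 : RCLike.re ((ω ^ 2 : ℂ) * (conj (R' t) * R t)) =
          ω ^ 2 * RCLike.re (conj (R t) * R' t) := by
        have hsw := re_conj_mul_swap (R' t) (R t)
        simp only [RCLike.re_to_complex] at hsw ⊢
        rw [show ((ω : ℂ) ^ 2) = ((ω ^ 2 : ℝ) : ℂ) by push_cast; ring, Complex.re_ofReal_mul,
          hsw]
      rw [h2]
      ring
    have hb1 : 2 * RCLike.re (conj (R' t) * (p t * R' t)) ≤ 2 * (C₁ / t) * ‖R' t‖ ^ 2 := by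
      have h := abs_re_conj_mul_le (R' t) (p t * R' t)
      rw [norm_mul] at h
      have h' : RCLike.re (conj (R' t) * (p t * R' t)) ≤ ‖p t‖ * ‖R' t‖ ^ 2 := by
        have := le_abs_self (RCLike.re (conj (R' t) * (p t * R' t)))
        nlinarith [norm_nonneg (R' t), norm_nonneg (p t)]
      have h'' : ‖p t‖ * ‖R' t‖ ^ 2 ≤ C₁ / t * ‖R' t‖ ^ 2 :=
        mul_le_mul_of_nonneg_right hpt (sq_nonneg _)
      linarith
    have hb2 : 2 * RCLike.re (conj (R' t) * ((q t + ω ^ 2) * R t)) ≤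
        (C₂ / t) * (E t / |ω|) := by
      have h := abs_re_conj_mul_le (R' t) ((q t + ω ^ 2) * R t)
      rw [norm_mul] at h
      have h' : 2 * RCLike.re (conj (R' t) * ((q t + ω ^ 2) * R t)) ≤
          ‖q t + ω ^ 2‖ * (2 * (‖R' t‖ * ‖R t‖)) := by
        have := le_abs_self (RCLike.re (conj (R' t) * ((q t + ω ^ 2) * R t)))
        nlinarith [norm_nonneg (R' t), norm_nonneg (q t + ω ^ 2), norm_nonneg (R t)]
      have hamgm : 2 * (‖R' t‖ * ‖R t‖) ≤ E t / |ω| := by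
        rw [le_div_iff₀ hω']
        show 2 * (‖R' t‖ * ‖R t‖) * |ω| ≤ ‖R' t‖ ^ 2 + ω ^ 2 * ‖R t‖ ^ 2
        nlinarith [sq_nonneg (|ω| * ‖R t‖ - ‖R' t‖), sq_abs ω, norm_nonneg (R t),
          norm_nonneg (R' t)]
      calc _ ≤ ‖q t + ω ^ 2‖ * (2 * (‖R' t‖ * ‖R t‖)) := h'
        _ ≤ (C₂ / t) * (E t / |ω|) :=
            mul_le_mul hqt hamgm (by positivity) (div_nonneg hC₂ ht0.le)
    have hR'le : ‖R' t‖ ^ 2 ≤ E t := by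
      simp only [hE]
      nlinarith [sq_nonneg ω, norm_nonneg (R t)]
    rw [hE't]
    calc _ ≤ 2 * (C₁ / t) * ‖R' t‖ ^ 2 + (C₂ / t) * (E t / |ω|) := add_le_add hb1 hb2
      _ ≤ 2 * (C₁ / t) * E t + (C₂ / t) * (E t / |ω|) := by
          gcongr
      _ = κ / t * E t := by
          simp only [hκ]
          field_simp
  -- `F = E · t^{−κ}` is non-increasing on `[X, ∞)`
  set F : ℝ → ℝ := fun t => E t * t ^ (-κ) with hF
  have hFd : ∀ t, X ≤ t → HasDerivAt F (E' t * t ^ (-κ) + E t * (-κ * t ^ (-κ - 1))) t := by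
    intro t ht
    have ht0 : 0 < t := hX0.trans_le ht
    exact (hEd t ht).mul (Real.hasDerivAt_rpow_const (Or.inl ht0.ne'))
  have hFd_nonpos : ∀ t, X ≤ t → E' t * t ^ (-κ) + E t * (-κ * t ^ (-κ - 1)) ≤ 0 := by
    intro t ht
    have ht0 : 0 < t := hX0.trans_le ht
    have h1 : E' t * t ^ (-κ) ≤ κ / t * E t * t ^ (-κ) :=
      mul_le_mul_of_nonneg_right (hineq t ht) (Real.rpow_nonneg ht0.le _)
    have h2 : κ / t * E t * t ^ (-κ) = -(E t * (-κ * t ^ (-κ - 1))) := by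
      rw [Real.rpow_sub ht0, Real.rpow_one]
      field_simp
    linarith
  have hanti : AntitoneOn F (Ici X) := by
    refine antitoneOn_of_deriv_nonpos (convex_Ici X) ?_ ?_ ?_
    · exact fun t ht => (hFd t ht).continuousAt.continuousWithinAt
    · intro t ht
      rw [interior_Ici] at ht
      exact (hFd t (le_of_lt ht)).differentiableAt.differentiableWithinAt
    · intro t ht
      rw [interior_Ici] at ht
      rw [(hFd t (le_of_lt ht)).deriv]
      exact hFd_nonpos t (le_of_lt ht)
  have hFle : F r ≤ F X := hanti (self_mem_Ici) hr hr
  -- unwind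
  have hr0 : 0 < r := hX0.trans_le hr
  have hrX : (r / X) ^ κ = r ^ κ * X ^ (-κ) := by
    rw [Real.div_rpow hr0.le hX0.le, Real.rpow_neg hX0.le, div_eq_mul_inv]
  have hEr : E r = F r * r ^ κ := by
    simp only [hF]
    rw [mul_assoc, ← Real.rpow_add hr0, neg_add_cancel, Real.rpow_zero, mul_one]
  show E r ≤ E X * (r / X) ^ κ
  rw [hEr, hrX]
  calc F r * r ^ κ ≤ F X * r ^ κ := mul_le_mul_of_nonneg_right hFle (Real.rpow_nonneg hr0.le _)
    _ = E X * (r ^ κ * X ^ (-κ)) := by simp only [hF]; ring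


/-! ### Asymptotic toolkit, III: the radial ODE at `r = ∞` — normal form and `O(1/r)` bounds

The coefficient estimates that feed `energy_le_mul_rpow_of_ode`: in the normal form
`R'' = pR' + qR` of the radial Teukolsky ODE, `p = −2(s+1)(r−M)/Δ = O(1/r)` and
`q + ω² = [(ωΔ−K)(ωΔ+K) + 2is(r−M)K − (4isωr − L')Δ]/Δ² = O(1/r)` (the quartic terms of
`ω²Δ² − K²` cancel: `ωΔ − K = −2Mωr + am`). Consequently the energy `‖R'‖² + ω²‖R‖²` of every
classical solution grows at most polynomially at infinity (`radial_energy_growth`). -/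


/-- `Δ ≥ r²/4` for `r ≥ 2r₊` (`|a| ≤ M`). [folklore] -/
theorem sq_div_four_le_delta {M a : ℝ} (hM : 0 < M) (ha : |a| ≤ M) {r : ℝ}
    (hr : 2 * rPlus M a ≤ r) : r ^ 2 / 4 ≤ delta M a r := by
  rw [delta_eq_mul ha]
  have hrp : 0 < rPlus M a := by unfold rPlus; positivity
  have h1 : r / 2 ≤ r - rPlus M a := by linarith
  have h2 : r / 2 ≤ r - rMinus M a := by linarith [rMinus_le_rPlus M a]
  have h0 : 0 ≤ r / 2 := by linarith
  nlinarith [mul_le_mul h1 h2 h0 (h0.trans h1)]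

/-- `Δ ≤ 2r²` for `r ≥ |a|`, `M ≥ 0`, `r ≥ 0`. [folklore] -/
theorem delta_le_two_sq {M a r : ℝ} (hM : 0 ≤ M) (hr : 0 ≤ r) (hra : |a| ≤ r) :
    delta M a r ≤ 2 * r ^ 2 := by
  unfold delta
  have ha2 : a ^ 2 ≤ r ^ 2 := by nlinarith [sq_abs a, abs_nonneg a]
  nlinarith

/-- `|K| = |ω(r²+a²) − am| ≤ (2|ω| + |am|) r²` for `r ≥ 1`, `r ≥ |a|`. [folklore] -/
theorem abs_radialK_le {a ω m r : ℝ} (hr1 : 1 ≤ r) (hra : |a| ≤ r) :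
    |radialK a ω m r| ≤ (2 * |ω| + |a * m|) * r ^ 2 := by
  have ha2 : a ^ 2 ≤ r ^ 2 := by nlinarith [sq_abs a, abs_nonneg a]
  have hr2 : 1 ≤ r ^ 2 := by nlinarith
  unfold radialK
  calc |ω * (r ^ 2 + a ^ 2) - a * m| ≤ |ω * (r ^ 2 + a ^ 2)| + |a * m| := abs_sub _ _
    _ = |ω| * (r ^ 2 + a ^ 2) + |a * m| := by
        rw [abs_mul, abs_of_nonneg (by positivity : (0:ℝ) ≤ r ^ 2 + a ^ 2)]
    _ ≤ |ω| * (2 * r ^ 2) + |a * m| * r ^ 2 := by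
        have h1 : |ω| * (r ^ 2 + a ^ 2) ≤ |ω| * (2 * r ^ 2) :=
          mul_le_mul_of_nonneg_left (by linarith) (abs_nonneg ω)
        have h2 : |a * m| ≤ |a * m| * r ^ 2 := by
          have := mul_le_mul_of_nonneg_left hr2 (abs_nonneg (a * m))
          linarith
        linarith
    _ = (2 * |ω| + |a * m|) * r ^ 2 := by ring

/-- The normalised zeroth-order coefficient of the radial ODE plus `ω²`, over the common
denominator `Δ²`: with `K = ω(r²+a²) − am`, `L' = λ + a²ω² − 2amω`,
`−V/Δ + ω² = [(ωΔ − K)(ωΔ + K) + 2is(r−M)K − (4isωr − L')Δ]/Δ²`. [folklore] -/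
theorem neg_potential_div_delta_add_sq (M a s ω m lam : ℝ) {r : ℝ} (hΔ : delta M a r ≠ 0) :
    -((((radialK a ω m r ^ 2 : ℝ) : ℂ) -
            2 * Complex.I * (s : ℂ) * ((r - M : ℝ) : ℂ) * (radialK a ω m r : ℂ)) / (delta M a r : ℂ) +
          4 * Complex.I * (s : ℂ) * (ω : ℂ) * (r : ℂ) - (lam : ℂ) - ((a ^ 2 * ω ^ 2 : ℝ) : ℂ) +
        ((2 * a * m * ω : ℝ) : ℂ)) / (delta M a r : ℂ) + ω ^ 2 =
      ((((ω * delta M a r - radialK a ω m r) * (ω * delta M a r + radialK a ω m r) : ℝ) : ℂ) +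
          2 * Complex.I * s * ((r - M : ℝ) : ℂ) * (radialK a ω m r : ℂ) -
          (4 * Complex.I * s * ω * r - ((lam + a ^ 2 * ω ^ 2 - 2 * a * m * ω : ℝ) : ℂ)) *
            (delta M a r : ℂ)) / (delta M a r : ℂ) ^ 2 := by
  have hΔc : (delta M a r : ℂ) ≠ 0 := by exact_mod_cast hΔ
  push_cast
  field_simp
  ring

/-- `ωΔ − K = −2Mωr + am`. [folklore] -/
theorem omega_mul_delta_sub_radialK (M a ω m r : ℝ) :
    ω * delta M a r - radialK a ω m r = -(2 * M * ω * r) + a * m := by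
  unfold delta radialK
  ring

/-- **Normal form of the radial ODE with `O(1/r)` coefficient bounds at infinity.** There are
coefficient functions `p, q` and a threshold `X > r₊`, `X ≥ 1`, with `‖p(r)‖ ≤ C₁/r`,
`‖q(r) + ω²‖ ≤ C₂/r` for `r ≥ X`, such that every classical solution of the radial Teukolsky
ODE (`Kerr.IsRadialTeukolskySolution`) satisfies `R'' = p R' + q R` on `(r₊, ∞)`
(`p = −2(s+1)(r−M)/Δ`, `q = −V/Δ`; at the irregular singular point `r = ∞`,
`q → −ω²`). [cite: Costa2019, §2.2.3 ("an irregular singularity of rank 1 at `r = ∞`")] -/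
theorem radial_normalForm_bounds {M a : ℝ} (hM : 0 < M) (ha : |a| < M) (s ω m lam : ℝ) :
    ∃ (p q : ℝ → ℂ) (X C₁ C₂ : ℝ), 1 ≤ X ∧ rPlus M a < X ∧
      (∀ r, X ≤ r → ‖p r‖ ≤ C₁ / r) ∧ (∀ r, X ≤ r → ‖q r + ω ^ 2‖ ≤ C₂ / r) ∧
      ∀ R : ℝ → ℂ, IsRadialTeukolskySolution M a s ω m lam R →
        ∃ R' R'' : ℝ → ℂ, ∀ r, rPlus M a < r →
          HasDerivAt R (R' r) r ∧ HasDerivAt R' (R'' r) r ∧ R'' r = p r * R' r + q r * R r := by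
  -- the coefficients (`V` verbatim from `Kerr.IsRadialTeukolskySolution`)
  set V : ℝ → ℂ := fun r =>
    (((radialK a ω m r ^ 2 : ℝ) : ℂ) -
          2 * Complex.I * (s : ℂ) * ((r - M : ℝ) : ℂ) * (radialK a ω m r : ℂ)) / (delta M a r : ℂ) +
        4 * Complex.I * (s : ℂ) * (ω : ℂ) * (r : ℂ) - (lam : ℂ) - ((a ^ 2 * ω ^ 2 : ℝ) : ℂ) +
      ((2 * a * m * ω : ℝ) : ℂ) with hV
  set p : ℝ → ℂ := fun r => -(2 * ((s + 1 : ℝ) : ℂ) * ((r - M : ℝ) : ℂ)) / (delta M a r : ℂ)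
    with hp
  set q : ℝ → ℂ := fun r => -V r / (delta M a r : ℂ) with hq
  set L' : ℝ := lam + a ^ 2 * ω ^ 2 - 2 * a * m * ω with hL'
  have hrp : 0 < rPlus M a := by unfold rPlus; positivity
  set X : ℝ := 2 * rPlus M a + 2 * M + |a| + 1 with hX
  set Cn : ℝ := (2 * M * |ω| + |a * m|) * (4 * |ω| + |a * m|) +
    2 * |s| * (2 * |ω| + |a * m|) + 2 * (4 * |s * ω| + |L'|) with hCn
  have hCn0 : 0 ≤ Cn := by positivity
  refine ⟨p, q, X, 8 * |s + 1|, 16 * Cn, by nlinarith [abs_nonneg a],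
    by nlinarith [abs_nonneg a], fun r hr => ?_, fun r hr => ?_, fun R hR => ?_⟩
  · -- `‖p‖ ≤ 8|s+1|/r`
    have hr0 : 0 < r := by nlinarith [abs_nonneg a]
    have hrM : M ≤ r := by nlinarith [abs_nonneg a]
    have hΔ := sq_div_four_le_delta hM ha.le (show 2 * rPlus M a ≤ r by nlinarith [abs_nonneg a])
    have hΔ0 : 0 < delta M a r := by nlinarith
    have hnorm : ‖p r‖ = 2 * |s + 1| * |r - M| / delta M a r := by
      simp only [hp]
      rw [norm_div, norm_neg, norm_mul, norm_mul, Complex.norm_real, Complex.norm_real,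
        Complex.norm_real, Complex.norm_two, Real.norm_eq_abs, Real.norm_eq_abs,
        Real.norm_eq_abs, abs_of_pos hΔ0]
    rw [hnorm, div_le_div_iff₀ hΔ0 hr0]
    have hrM' : |r - M| ≤ r := by rw [abs_of_nonneg (by linarith)]; linarith
    calc 2 * |s + 1| * |r - M| * r ≤ 2 * |s + 1| * r * r := by gcongr
      _ = 8 * |s + 1| * (r ^ 2 / 4) := by ring
      _ ≤ 8 * |s + 1| * delta M a r := by gcongr
  · -- `‖q + ω²‖ ≤ 16 Cn / r`
    have hr1 : 1 ≤ r := by nlinarith [abs_nonneg a]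
    have hr0 : 0 < r := one_pos.trans_le hr1
    have hrM : M ≤ r := by nlinarith [abs_nonneg a]
    have hra : |a| ≤ r := by nlinarith [abs_nonneg a]
    have hΔ := sq_div_four_le_delta hM ha.le (show 2 * rPlus M a ≤ r by nlinarith [abs_nonneg a])
    have hΔ0 : 0 < delta M a r := by nlinarith
    have hΔup := delta_le_two_sq hM.le hr0.le hra
    have hK := abs_radialK_le (ω := ω) (m := m) hr1 hra
    have hrM' : |r - M| ≤ r := by rw [abs_of_nonneg (by linarith)]; linarith
    -- the three numerator terms
    have hT1 : |(ω * delta M a r - radialK a ω m r) * (ω * delta M a r + radialK a ω m r)| ≤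
        (2 * M * |ω| + |a * m|) * (4 * |ω| + |a * m|) * r ^ 3 := by
      have h1' : |ω * delta M a r - radialK a ω m r| ≤ (2 * M * |ω| + |a * m|) * r := by
        rw [omega_mul_delta_sub_radialK]
        calc |-(2 * M * ω * r) + a * m| ≤ |-(2 * M * ω * r)| + |a * m| := abs_add_le _ _
          _ = 2 * M * |ω| * r + |a * m| := by
              rw [abs_neg, abs_mul, abs_mul, abs_mul, abs_of_pos hM, abs_of_pos hr0, abs_two]
          _ ≤ 2 * M * |ω| * r + |a * m| * r := by
              have := mul_le_mul_of_nonneg_left hr1 (abs_nonneg (a * m))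
              linarith
          _ = (2 * M * |ω| + |a * m|) * r := by ring
      have h2' : |ω * delta M a r + radialK a ω m r| ≤ (4 * |ω| + |a * m|) * r ^ 2 := by
        calc |ω * delta M a r + radialK a ω m r| ≤ |ω * delta M a r| + |radialK a ω m r| :=
              abs_add_le _ _
          _ ≤ |ω| * (2 * r ^ 2) + (2 * |ω| + |a * m|) * r ^ 2 := by
              rw [abs_mul, abs_of_pos hΔ0]
              exact add_le_add (mul_le_mul_of_nonneg_left hΔup (abs_nonneg ω)) hK
          _ = (4 * |ω| + |a * m|) * r ^ 2 := by ring
      rw [abs_mul]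
      calc |ω * delta M a r - radialK a ω m r| * |ω * delta M a r + radialK a ω m r| ≤
          ((2 * M * |ω| + |a * m|) * r) * ((4 * |ω| + |a * m|) * r ^ 2) :=
            mul_le_mul h1' h2' (abs_nonneg _) (by positivity)
        _ = _ := by ring
    have hT2 : ‖2 * Complex.I * s * ((r - M : ℝ) : ℂ) * (radialK a ω m r : ℂ)‖ ≤
        2 * |s| * (2 * |ω| + |a * m|) * r ^ 3 := by
      rw [norm_mul, norm_mul, norm_mul, norm_mul, Complex.norm_I, Complex.norm_real,
        Complex.norm_real, Complex.norm_real, Complex.norm_two, Real.norm_eq_abs,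
        Real.norm_eq_abs, Real.norm_eq_abs, mul_one]
      calc 2 * |s| * |r - M| * |radialK a ω m r| ≤ 2 * |s| * r * ((2 * |ω| + |a * m|) * r ^ 2) := by
            gcongr
        _ = _ := by ring
    have hT3 : ‖(4 * Complex.I * s * ω * r - (L' : ℂ)) * (delta M a r : ℂ)‖ ≤
        2 * (4 * |s * ω| + |L'|) * r ^ 3 := by
      rw [norm_mul, Complex.norm_real, Real.norm_eq_abs, abs_of_pos hΔ0]
      have h1 : ‖4 * Complex.I * s * ω * r - (L' : ℂ)‖ ≤ 4 * |s * ω| * r + |L'| := by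
        calc ‖4 * Complex.I * s * ω * r - (L' : ℂ)‖ ≤ ‖4 * Complex.I * (s : ℂ) * ω * r‖ + ‖(L' : ℂ)‖ :=
              norm_sub_le _ _
          _ = 4 * |s * ω| * r + |L'| := by
              rw [norm_mul, norm_mul, norm_mul, norm_mul, Complex.norm_I, Complex.norm_real,
                Complex.norm_real, Complex.norm_real, Complex.norm_real, Real.norm_eq_abs,
                Real.norm_eq_abs, Real.norm_eq_abs, Real.norm_eq_abs, abs_of_pos hr0, abs_mul,
                show ‖(4 : ℂ)‖ = 4 by simp]
              ring
      calc ‖4 * Complex.I * s * ω * r - (L' : ℂ)‖ * delta M a r ≤ (4 * |s * ω| * r + |L'|) * (2 * r ^ 2) :=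
            mul_le_mul h1 hΔup hΔ0.le (by positivity)
        _ ≤ (4 * |s * ω| * r + |L'| * r) * (2 * r ^ 2) := by
            have := mul_le_mul_of_nonneg_left hr1 (abs_nonneg L')
            gcongr
            linarith
        _ = _ := by ring
    -- assemble
    have hident : q r + ω ^ 2 = ((((ω * delta M a r - radialK a ω m r) *
        (ω * delta M a r + radialK a ω m r) : ℝ) : ℂ) +
          2 * Complex.I * s * ((r - M : ℝ) : ℂ) * (radialK a ω m r : ℂ) -
          (4 * Complex.I * s * ω * r - (L' : ℂ)) * (delta M a r : ℂ)) / (delta M a r : ℂ) ^ 2 := by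
      simp only [hq, hV, hL']
      exact neg_potential_div_delta_add_sq M a s ω m lam hΔ0.ne'
    have hN : ‖(((ω * delta M a r - radialK a ω m r) * (ω * delta M a r + radialK a ω m r) : ℝ) : ℂ) +
          2 * Complex.I * s * ((r - M : ℝ) : ℂ) * (radialK a ω m r : ℂ) -
          (4 * Complex.I * s * ω * r - (L' : ℂ)) * (delta M a r : ℂ)‖ ≤ Cn * r ^ 3 := by
      refine (norm_sub_le _ _).trans ?_
      refine (add_le_add (norm_add_le _ _) le_rfl).trans ?_
      rw [Complex.norm_real, Real.norm_eq_abs]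
      calc _ ≤ ((2 * M * |ω| + |a * m|) * (4 * |ω| + |a * m|) * r ^ 3 +
            2 * |s| * (2 * |ω| + |a * m|) * r ^ 3) + 2 * (4 * |s * ω| + |L'|) * r ^ 3 :=
            add_le_add (add_le_add hT1 hT2) hT3
        _ = Cn * r ^ 3 := by simp only [hCn]; ring
    rw [hident, norm_div, norm_pow, Complex.norm_real, Real.norm_eq_abs, abs_of_pos hΔ0,
      div_le_div_iff₀ (by positivity) hr0]
    calc _ ≤ Cn * r ^ 3 * r := by gcongr
      _ = 16 * Cn * (r ^ 2 / 4) ^ 2 := by ring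
      _ ≤ 16 * Cn * delta M a r ^ 2 := by gcongr
  · -- the normal form
    obtain ⟨R', R'', hR⟩ := hR
    refine ⟨R', R'', fun r hr => ?_⟩
    obtain ⟨h1, h2, hode⟩ := hR r hr
    have hΔt : (delta M a r : ℂ) ≠ 0 := by exact_mod_cast (delta_pos ha.le hr).ne'
    have h3 : (delta M a r : ℂ) * R'' r = -(2 * ((s + 1 : ℝ) : ℂ) * ((r - M : ℝ) : ℂ) * R' r +
        V r * R r) := by
      simp only [hV]
      linear_combination hode
    have h4 : R'' r = p r * R' r + q r * R r := by
      simp only [hp, hq]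
      field_simp
      linear_combination h3
    exact ⟨h1, h2, h4⟩

/-- **Polynomial growth of radial solutions and their derivatives at infinity.** For real
`ω ≠ 0` there are `X > r₊` and `κ ≥ 0` such that every classical solution `R` of the radial
Teukolsky ODE with derivative `R₁` on `(r₊, ∞)` satisfies
`‖R₁(r)‖² + ω²‖R(r)‖² ≤ (‖R₁(X)‖² + ω²‖R(X)‖²)(r/X)^κ` for `r ≥ X`; in particular `R` and `R'`
grow at most polynomially (the input for the vanishing of the boundary terms at `r = ∞` in the
proof of TdC Lemma 3.12 for `Im z ≠ 0`). [cite: Costa2019, Lemma 3.12 (proof: "This is clear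
at `r = ∞`, due to the decay of `g` and `dg/dr`, together with the exponential decay")] -/
theorem radial_energy_growth {M a : ℝ} (hM : 0 < M) (ha : |a| < M) {ω : ℝ} (hω : ω ≠ 0)
    (s m lam : ℝ) :
    ∃ X κ : ℝ, rPlus M a < X ∧ 1 ≤ X ∧ 0 ≤ κ ∧
      ∀ R R₁ : ℝ → ℂ, IsRadialTeukolskySolution M a s ω m lam R →
        (∀ r, rPlus M a < r → HasDerivAt R (R₁ r) r) →
          ∀ r, X ≤ r → ‖R₁ r‖ ^ 2 + ω ^ 2 * ‖R r‖ ^ 2 ≤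
            (‖R₁ X‖ ^ 2 + ω ^ 2 * ‖R X‖ ^ 2) * (r / X) ^ κ := by
  obtain ⟨p, q, X, C₁, C₂, hX1, hXr, hp, hq, hnf⟩ := radial_normalForm_bounds hM ha s ω m lam
  have hX0 : 0 < X := one_pos.trans_le hX1
  have hC₁ : 0 ≤ C₁ := by
    have h : 0 ≤ C₁ / X := (norm_nonneg _).trans (hp X le_rfl)
    exact (div_nonneg_iff.1 h).elim (fun h => h.1) fun h => absurd h.2 (not_le.2 hX0)
  have hC₂ : 0 ≤ C₂ := by
    have h : 0 ≤ C₂ / X := (norm_nonneg _).trans (hq X le_rfl)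
    exact (div_nonneg_iff.1 h).elim (fun h => h.1) fun h => absurd h.2 (not_le.2 hX0)
  refine ⟨X, 2 * C₁ + C₂ / |ω|, hXr, hX1, by positivity, fun R R₁ hR hR₁ r hr => ?_⟩
  obtain ⟨R', R'', hRnf⟩ := hnf R hR
  have heq : ∀ t, X ≤ t → R₁ t = R' t := fun t ht =>
    (hR₁ t (hXr.trans_le ht)).unique (hRnf t (hXr.trans_le ht)).1
  have h := energy_le_mul_rpow_of_ode (R := R) (R' := R') (R'' := R'') hX1 hω
    (fun t ht => hRnf t (hXr.trans_le ht)) hp hq hr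
  rw [heq r hr, heq X le_rfl]
  exact h


/-! ### Asymptotic toolkit, IV: exponentially damped parametric integrals

Generic inputs for Whiting's transform off the real axis (TdC §3.2, proof of Lemma 3.12: for
`yω > 0` "the integral is absolutely convergent and we can thus differentiate under the
integral"): integrability on a half-line from an `e^{−c r}(1+r)ⁿ` bound, and differentiation of
`x ↦ ∫_S κ(x, r) Φ(r) dr` under the integral sign with an `x`-independent domination
(Mathlib's `hasDerivAt_integral_of_dominated_loc_of_deriv_le`). -/

/-- `r ↦ e^{−c(r−r₀)} (1+r)ⁿ` is integrable on every half-line `(b, ∞)` (`c > 0`). [folklore] -/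
theorem integrableOn_exp_neg_mul_pow {c : ℝ} (hc : 0 < c) (r₀ : ℝ) (n : ℕ) (b : ℝ) :
    IntegrableOn (fun r : ℝ => Real.exp (-c * (r - r₀)) * (1 + r) ^ n) (Ioi b) := by
  have hcont : ContinuousOn (fun r : ℝ => Real.exp (-c * (r - r₀)) * (1 + r) ^ n) (Ici b) :=
    ((Real.continuous_exp.comp (continuous_const.mul (continuous_id.sub continuous_const))).mul
      ((continuous_const.add continuous_id).pow n)).continuousOn
  refine integrable_of_isBigO_exp_neg (half_pos hc) hcont ?_
  have h1 : (fun r : ℝ => r ^ n) =o[atTop] fun r => Real.exp (c / 2 * r) :=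
    isLittleO_pow_exp_pos_mul_atTop n (half_pos hc)
  have h2 : (fun r : ℝ => (1 + r) ^ n) =O[atTop] fun r : ℝ => r ^ n := by
    refine Asymptotics.IsBigO.of_bound ((2 : ℝ) ^ n) ?_
    filter_upwards [eventually_ge_atTop (1 : ℝ)] with r hr
    rw [Real.norm_eq_abs, Real.norm_eq_abs, abs_of_nonneg (by positivity),
      abs_of_nonneg (by positivity), ← mul_pow]
    exact pow_le_pow_left₀ (by positivity) (by linarith) n
  have h3 : (fun r : ℝ => (1 + r) ^ n) =O[atTop] fun r => Real.exp (c / 2 * r) :=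
    h2.trans h1.isBigO
  have h4 : (fun r : ℝ => Real.exp (-c * (r - r₀)) * (1 + r) ^ n) =O[atTop]
      fun r => Real.exp (-c * (r - r₀)) * Real.exp (c / 2 * r) :=
    (Asymptotics.isBigO_refl (fun r : ℝ => Real.exp (-c * (r - r₀))) atTop).mul h3
  refine h4.trans ?_
  refine Asymptotics.isBigO_of_le' (c := Real.exp (c * r₀)) _ fun r => le_of_eq ?_
  rw [Real.norm_eq_abs, Real.norm_eq_abs, abs_of_nonneg (by positivity), abs_of_nonneg
    (Real.exp_pos _).le, ← Real.exp_add, ← Real.exp_add]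
  congr 1
  ring

/-- **Integrability on a half-line from an exponential-times-polynomial bound**: a function
continuous on `(b, ∞)` with `‖f(r)‖ ≤ C e^{−c(r−r₀)} (1+r)ⁿ` there (`c > 0`) is integrable on
`(b, ∞)`. [folklore] -/
theorem integrableOn_Ioi_of_norm_le_exp_mul_pow {E : Type*} [NormedAddCommGroup E] {f : ℝ → E}
    {b c C : ℝ} {n : ℕ} (hc : 0 < c) (r₀ : ℝ) (hf : ContinuousOn f (Ioi b))
    (hle : ∀ r, b < r → ‖f r‖ ≤ C * (Real.exp (-c * (r - r₀)) * (1 + r) ^ n)) :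
    IntegrableOn f (Ioi b) := by
  have hg : IntegrableOn (fun r : ℝ => C * (Real.exp (-c * (r - r₀)) * (1 + r) ^ n)) (Ioi b) :=
    (integrableOn_exp_neg_mul_pow hc r₀ n b).const_mul C
  refine hg.mono' (hf.aestronglyMeasurable measurableSet_Ioi) ?_
  exact ae_restrict_of_forall_mem measurableSet_Ioi fun r hr => hle r hr

/-- **Differentiation under a set integral with `x`-independent domination.** If
`x ↦ κ(x, r)` has derivative `κ'(x, r)` for every `r ∈ S`, all kernels are continuous in `r` on
`S`, `Φ` is continuous on `S`, `κ(x₀, ·)Φ` is integrable on `S` and `‖κ'(x, r)Φ(r)‖ ≤ bound(r)`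
for ALL `x` with `bound` integrable on `S`, then `x ↦ ∫_S κ(x, r)Φ(r) dr` has derivative
`∫_S κ'(x₀, r)Φ(r) dr` at `x₀` (and the latter integrand is integrable).
[folklore] -/
theorem hasDerivAt_setIntegral_mul {κ κ' : ℝ → ℝ → ℂ} {Φ : ℝ → ℂ} {S : Set ℝ}
    (hS : MeasurableSet S) {bound : ℝ → ℝ} {x₀ : ℝ}
    (hκc : ∀ x, ContinuousOn (κ x) S) (hκ'c : ContinuousOn (κ' x₀) S) (hΦc : ContinuousOn Φ S)
    (hint : IntegrableOn (fun r => κ x₀ r * Φ r) S)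
    (hbound : ∀ r ∈ S, ∀ x, ‖κ' x r * Φ r‖ ≤ bound r) (hbi : IntegrableOn bound S)
    (hderiv : ∀ r ∈ S, ∀ x, HasDerivAt (fun x => κ x r) (κ' x r) x) :
    IntegrableOn (fun r => κ' x₀ r * Φ r) S ∧
      HasDerivAt (fun x => ∫ r in S, κ x r * Φ r) (∫ r in S, κ' x₀ r * Φ r) x₀ := by
  have hF_meas : ∀ᶠ x in 𝓝 x₀,
      AEStronglyMeasurable (fun r => κ x r * Φ r) (volume.restrict S) :=
    Filter.Eventually.of_forall fun x => ((hκc x).mul hΦc).aestronglyMeasurable hS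
  have hF'_meas : AEStronglyMeasurable (fun r => κ' x₀ r * Φ r) (volume.restrict S) :=
    (hκ'c.mul hΦc).aestronglyMeasurable hS
  have h_bound : ∀ᵐ r ∂(volume.restrict S), ∀ x ∈ (univ : Set ℝ), ‖κ' x r * Φ r‖ ≤ bound r :=
    ae_restrict_of_forall_mem hS fun r hr x _ => hbound r hr x
  have h_diff : ∀ᵐ r ∂(volume.restrict S), ∀ x ∈ (univ : Set ℝ),
      HasDerivAt (fun x => κ x r * Φ r) (κ' x r * Φ r) x :=
    ae_restrict_of_forall_mem hS fun r hr x _ => (hderiv r hr x).mul_const (Φ r)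
  exact hasDerivAt_integral_of_dominated_loc_of_deriv_le Filter.univ_mem hF_meas hint hF'_meas
    h_bound hbi h_diff


/-! ### Asymptotic toolkit, V: outgoing solutions are polynomially bounded on `(r₊, ∞)`

The two boundary conditions of an outgoing solution give a global bound
`‖R(r)‖ ≤ C (1 + r)^{⌈−2s⌉}` on `(r₊, ∞)` for `s ≤ 0`: near `𝓗⁺`,
`R = f (r − r₊)^{ξ−s}` with `f` smooth and `|(r−r₊)^{ξ−s}| = (r−r₊)^{−s} ≤ 1` (`ξ` is purely
imaginary for real `ω`); at infinity the outgoing expansion with `N = 1` gives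
`‖R‖ ≤ (|c₀| + |c₁| + C) r^{−2s−1}`; in between `R` is continuous. This is the polynomial bound
`Φ = O(r^k)` under which the transform converges off the real axis
(`TeukolskyWhitingTransform.lean`). -/

/-- The horizon exponent is purely imaginary (real `ω`): `Re ξ = 0`. [cite: Costa2019, §2.2.1] -/
theorem horizonExponent_re (M a ω m : ℝ) : (horizonExponent M a ω m).re = 0 := by
  unfold horizonExponent
  generalize (2 * M * rPlus M a / (rPlus M a - rMinus M a) *
    (ω - m * horizonAngularVelocity M a) : ℝ) = t
  simp [Complex.mul_re, Complex.I_re, Complex.I_im, Complex.ofReal_re, Complex.ofReal_im]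

/-- The oscillatory factor of the outgoing expansion has modulus one:
`|e^{iωr + 2iMω log r}| = 1`. [cite: Costa2019, Def. 2.3 (footnote)] -/
theorem norm_exp_outgoingPhase (M ω r : ℝ) :
    ‖Complex.exp (Complex.I * ω * r + 2 * Complex.I * M * ω * Real.log r)‖ = 1 := by
  have h : Complex.I * ω * r + 2 * Complex.I * M * ω * Real.log r =
      ((ω * r + 2 * M * ω * Real.log r : ℝ) : ℂ) * Complex.I := by
    push_cast
    ring
  rw [h, Complex.norm_exp_ofReal_mul_I]

/-- **Outgoing solutions are polynomially bounded on `(r₊, ∞)`** (`s ≤ 0`, `|a| < M`): a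
classical solution of the radial ODE which is outgoing at `𝓗⁺` and at `𝓘⁺` satisfies
`‖R(r)‖ ≤ C (1 + r)^{⌈−2s⌉₊}` for all `r > r₊`. [cite: Costa2019, §3.2.1 ("the integrand … is
`O((r−r₊)^{−s})` as `r → r₊` … as `r → ∞` … `O(… r^{−1−2s})`")] -/
theorem norm_le_mul_pow_of_outgoing {M a s ω m lam : ℝ} (ha : |a| < M) (hs : s ≤ 0)
    {R : ℝ → ℂ} (hsol : IsRadialTeukolskySolution M a s ω m lam R)
    (hH : IsOutgoingAtHorizon M a s ω m R) (hI : IsOutgoingAtInfinity M s ω R) :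
    ∃ C : ℝ, ∀ r, rPlus M a < r → ‖R r‖ ≤ C * (1 + r) ^ ⌈-2 * s⌉₊ := by
  set n : ℕ := ⌈-2 * s⌉₊ with hn
  have hn' : -2 * s ≤ n := Nat.le_ceil _
  -- continuity on `(r₊, ∞)`
  obtain ⟨R', R'', hR⟩ := hsol
  have hcont : ContinuousOn R (Ioi (rPlus M a)) := fun r hr =>
    (hR r hr).1.continuousAt.continuousWithinAt
  -- near the horizon
  obtain ⟨ε, hε, f, hf, hRf⟩ := hH
  set δ : ℝ := min (ε / 2) 1 with hδ
  have hδpos : 0 < δ := lt_min (by linarith) one_pos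
  have hδε : δ < ε := (min_le_left _ _).trans_lt (by linarith)
  have hδ1 : δ ≤ 1 := min_le_right _ _
  have hfc : ContinuousOn f (Icc (rPlus M a) (rPlus M a + δ)) :=
    hf.continuousOn.mono (Icc_subset_Ioo (by linarith) (by linarith))
  obtain ⟨B₁, hB₁⟩ := isCompact_Icc.exists_bound_of_continuousOn hfc
  have hhor : ∀ r, rPlus M a < r → r ≤ rPlus M a + δ → ‖R r‖ ≤ B₁ := by
    intro r hr hrδ
    have hx : 0 < r - rPlus M a := sub_pos.2 hr
    have hxc : ((r - rPlus M a : ℝ) : ℂ) ≠ 0 := by exact_mod_cast hx.ne'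
    have h1 := hRf r ⟨hr, by linarith⟩
    have h2 : R r = f r * ((r - rPlus M a : ℝ) : ℂ) ^ (horizonExponent M a ω m - (s : ℂ)) := by
      have h3 : ((r - rPlus M a : ℝ) : ℂ) ^ ((s : ℂ) - horizonExponent M a ω m) *
          ((r - rPlus M a : ℝ) : ℂ) ^ (horizonExponent M a ω m - (s : ℂ)) = 1 := by
        rw [← Complex.cpow_add _ _ hxc, sub_add_sub_cancel, sub_self, Complex.cpow_zero]
      calc R r = R r * (((r - rPlus M a : ℝ) : ℂ) ^ ((s : ℂ) - horizonExponent M a ω m) *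
          ((r - rPlus M a : ℝ) : ℂ) ^ (horizonExponent M a ω m - (s : ℂ))) := by rw [h3, mul_one]
        _ = f r * ((r - rPlus M a : ℝ) : ℂ) ^ (horizonExponent M a ω m - (s : ℂ)) := by
          rw [← mul_assoc, h1]
    rw [h2, norm_mul, Complex.norm_cpow_eq_rpow_re_of_pos hx]
    have hre : (horizonExponent M a ω m - (s : ℂ)).re = -s := by
      rw [Complex.sub_re, horizonExponent_re, Complex.ofReal_re]; ring
    rw [hre]
    have h4 : (r - rPlus M a) ^ (-s) ≤ 1 := Real.rpow_le_one hx.le (by linarith) (by linarith)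
    calc ‖f r‖ * (r - rPlus M a) ^ (-s) ≤ B₁ * 1 :=
        mul_le_mul (hB₁ r ⟨hr.le, hrδ⟩) h4 (Real.rpow_nonneg hx.le _)
          ((norm_nonneg _).trans (hB₁ r ⟨hr.le, hrδ⟩))
      _ = B₁ := mul_one _
  -- at infinity (`N = 1` in the outgoing expansion)
  obtain ⟨c, hc⟩ := hI
  obtain ⟨C₃, r₀, hfar⟩ := hc 1 le_rfl
  set X₃ : ℝ := max r₀ 1 with hX₃
  have hinf : ∀ r, X₃ ≤ r → ‖R r‖ ≤ (‖c 0‖ + ‖c 1‖ + |C₃|) * (1 + r) ^ n := by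
    intro r hr
    have hr₀ : r₀ ≤ r := (le_max_left _ _).trans hr
    have hr1 : 1 ≤ r := (le_max_right _ _).trans hr
    have hr0 : 0 < r := one_pos.trans_le hr1
    have h := hfar r hr₀
    have hpow : ∀ e : ℝ, e ≤ n → r ^ e ≤ (1 + r) ^ n := fun e he =>
      calc r ^ e ≤ r ^ (n : ℝ) := Real.rpow_le_rpow_of_exponent_le hr1 he
        _ = r ^ n := Real.rpow_natCast r n
        _ ≤ (1 + r) ^ n := pow_le_pow_left₀ hr0.le (by linarith) n
    have hsum : ‖Complex.exp (Complex.I * ω * r + 2 * Complex.I * M * ω * Real.log r) *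
        ∑ k ∈ Finset.range (1 + 1), c k * ((r ^ (-(2 * s) - (k : ℝ) - 1) : ℝ) : ℂ)‖ ≤
        (‖c 0‖ + ‖c 1‖) * (1 + r) ^ n := by
      rw [norm_mul, norm_exp_outgoingPhase, one_mul, Finset.sum_range_succ,
        Finset.sum_range_succ, Finset.sum_range_zero, zero_add]
      refine (norm_add_le _ _).trans ?_
      rw [norm_mul, norm_mul, Complex.norm_real, Complex.norm_real, Real.norm_eq_abs,
        Real.norm_eq_abs, abs_of_nonneg (Real.rpow_nonneg hr0.le _),
        abs_of_nonneg (Real.rpow_nonneg hr0.le _)]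
      have h0 := hpow (-(2 * s) - ((0 : ℕ) : ℝ) - 1) (by push_cast; linarith)
      have h1 := hpow (-(2 * s) - ((1 : ℕ) : ℝ) - 1) (by push_cast; linarith)
      have := norm_nonneg (c 0)
      have := norm_nonneg (c 1)
      nlinarith [mul_le_mul_of_nonneg_left h0 (norm_nonneg (c 0)),
        mul_le_mul_of_nonneg_left h1 (norm_nonneg (c 1))]
    have hrem : C₃ * r ^ (-(2 * s) - ((1 : ℕ) : ℝ) - 2) ≤ |C₃| * (1 + r) ^ n := by
      have h1 := hpow (-(2 * s) - ((1 : ℕ) : ℝ) - 2) (by push_cast; linarith)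
      calc C₃ * r ^ (-(2 * s) - ((1 : ℕ) : ℝ) - 2) ≤ |C₃| * r ^ (-(2 * s) - ((1 : ℕ) : ℝ) - 2) :=
          mul_le_mul_of_nonneg_right (le_abs_self _) (Real.rpow_nonneg hr0.le _)
        _ ≤ |C₃| * (1 + r) ^ n := mul_le_mul_of_nonneg_left h1 (abs_nonneg _)
    calc ‖R r‖ ≤ ‖R r - Complex.exp (Complex.I * ω * r + 2 * Complex.I * M * ω * Real.log r) *
          ∑ k ∈ Finset.range (1 + 1), c k * ((r ^ (-(2 * s) - (k : ℝ) - 1) : ℝ) : ℂ)‖ +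
        ‖Complex.exp (Complex.I * ω * r + 2 * Complex.I * M * ω * Real.log r) *
          ∑ k ∈ Finset.range (1 + 1), c k * ((r ^ (-(2 * s) - (k : ℝ) - 1) : ℝ) : ℂ)‖ :=
          (norm_le_insert' _ _).trans_eq (add_comm _ _)
      _ ≤ |C₃| * (1 + r) ^ n + (‖c 0‖ + ‖c 1‖) * (1 + r) ^ n := add_le_add (h.trans hrem) hsum
      _ = (‖c 0‖ + ‖c 1‖ + |C₃|) * (1 + r) ^ n := by ring
  -- in between
  have hmidc : ContinuousOn R (Icc (rPlus M a + δ) (X₃ + 1)) :=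
    hcont.mono fun r hr => lt_of_lt_of_le (by linarith) hr.1
  obtain ⟨B₂, hB₂⟩ := isCompact_Icc.exists_bound_of_continuousOn hmidc
  -- assemble
  set C : ℝ := max (max B₁ B₂) (‖c 0‖ + ‖c 1‖ + |C₃|) with hC
  have hC0 : 0 ≤ C := le_max_of_le_right (by positivity)
  refine ⟨C, fun r hr => ?_⟩
  have hr0 : 0 ≤ r := ((abs_nonneg a).trans_lt (ha.trans_le ?_)).le |>.trans hr.le
  swap
  · unfold rPlus
    have := Real.sqrt_nonneg (M ^ 2 - a ^ 2)
    linarith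
  have hpow1 : (1 : ℝ) ≤ (1 + r) ^ n := one_le_pow₀ (by linarith)
  rcases le_or_gt r (rPlus M a + δ) with h1 | h1
  · calc ‖R r‖ ≤ B₁ := hhor r hr h1
      _ ≤ C := (le_max_left _ _).trans (le_max_left _ _)
      _ ≤ C * (1 + r) ^ n := le_mul_of_one_le_right hC0 hpow1
  · rcases le_or_gt r (X₃ + 1) with h2 | h2
    · calc ‖R r‖ ≤ B₂ := hB₂ r ⟨h1.le, h2⟩
        _ ≤ C := (le_max_right _ _).trans (le_max_left _ _)
        _ ≤ C * (1 + r) ^ n := le_mul_of_one_le_right hC0 hpow1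
    · calc ‖R r‖ ≤ (‖c 0‖ + ‖c 1‖ + |C₃|) * (1 + r) ^ n := hinf r (by linarith)
        _ ≤ C * (1 + r) ^ n := mul_le_mul_of_nonneg_right (le_max_right _ _) (by positivity)


/-! ### Asymptotic toolkit, VI: one integration by parts against a decaying exponential

The step iterated in TdC Lemma 3.10 ("The latter can be integrated by parts, noting that
`e^{-A(z−r₋)(r−r₋)} d/dr (e^{A(z−r₋)(r−r₋)}) = A(z−r₋)` … The boundary terms generated by the
integration by parts at infinity will vanish when either `Im ω > 0` or `yω > 0` due to the
exponential decay"). -/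

/-- `‖e^{λ(r−r₁)}‖ = e^{Re λ (r − r₁)}`. [folklore] -/
theorem norm_exp_mul_sub (lam : ℂ) (r r₁ : ℝ) :
    ‖Complex.exp (lam * ((r - r₁ : ℝ) : ℂ))‖ = Real.exp (lam.re * (r - r₁)) := by
  rw [Complex.norm_exp]
  congr 1
  simp [Complex.mul_re, Complex.ofReal_re, Complex.ofReal_im]

/-- Polynomial times decaying exponential tends to zero. [folklore] -/
theorem tendsto_pow_mul_exp_neg_mul_sub {c : ℝ} (hc : 0 < c) (r₁ : ℝ) (k : ℕ) :
    Tendsto (fun r : ℝ => (1 + r) ^ k * Real.exp (-c * (r - r₁))) atTop (𝓝 0) := by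
  have h1 : (fun r : ℝ => r ^ k) =o[atTop] fun r => Real.exp (c / 2 * r) :=
    isLittleO_pow_exp_pos_mul_atTop k (half_pos hc)
  have h2 : (fun r : ℝ => (1 + r) ^ k) =O[atTop] fun r : ℝ => r ^ k := by
    refine Asymptotics.IsBigO.of_bound ((2 : ℝ) ^ k) ?_
    filter_upwards [eventually_ge_atTop (1 : ℝ)] with r hr
    rw [Real.norm_eq_abs, Real.norm_eq_abs, abs_of_nonneg (by positivity),
      abs_of_nonneg (by positivity), ← mul_pow]
    exact pow_le_pow_left₀ (by positivity) (by linarith) k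
  have h3 := (h2.trans_isLittleO h1).tendsto_div_nhds_zero
  have h4 : Tendsto (fun r : ℝ => Real.exp (-(c / 2) * r)) atTop (𝓝 0) :=
    Real.tendsto_exp_atBot.comp (tendsto_id.const_mul_atTop_of_neg (by linarith))
  have h5 := (h3.mul h4).const_mul (Real.exp (c * r₁))
  rw [mul_zero, mul_zero] at h5
  refine h5.congr' ?_
  filter_upwards [eventually_ge_atTop (0 : ℝ)] with r hr
  have hexp : Real.exp (c / 2 * r) ≠ 0 := (Real.exp_pos _).ne'
  field_simp
  rw [← Real.exp_add, ← Real.exp_add]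
  congr 1
  ring

/-- **One integration by parts against a decaying exponential on a half-line.** For
`Re λ < 0`, `f ∈ C¹[r₁, ∞)` with `f`, `f'` polynomially bounded,
`∫_{r₁}^∞ f(r) e^{λ(r−r₁)} dr = −f(r₁)/λ − (1/λ) ∫_{r₁}^∞ f'(r) e^{λ(r−r₁)} dr` (the boundary term
at infinity vanishes). This is the step iterated `1 − 2s + j` times in TdC Lemma 3.10 (there for
the kernel `e^{A(z−r₋)(r−r₋)}`, `Re(A(z−r₋)) < 0` iff `yω > 0`). [cite: Costa2019, Lemma 3.10 (proof)] -/
theorem integral_Ioi_mul_exp_eq_ibp {lam : ℂ} (hlam : lam.re < 0) {r₁ C : ℝ} {k : ℕ}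
    {f f' : ℝ → ℂ} (hf : ∀ r ∈ Ici r₁, HasDerivAt f (f' r) r) (hf'c : ContinuousOn f' (Ici r₁))
    (hfb : ∀ r ∈ Ici r₁, ‖f r‖ ≤ C * (1 + r) ^ k) (hf'b : ∀ r ∈ Ici r₁, ‖f' r‖ ≤ C * (1 + r) ^ k) :
    ∫ r in Ioi r₁, f r * Complex.exp (lam * ((r - r₁ : ℝ) : ℂ)) =
      -(f r₁) / lam - lam⁻¹ * ∫ r in Ioi r₁, f' r * Complex.exp (lam * ((r - r₁ : ℝ) : ℂ)) := by
  have hlam0 : lam ≠ 0 := fun h => by rw [h, Complex.zero_re] at hlam; exact lt_irrefl _ hlam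
  set c : ℝ := -lam.re with hc
  have hcpos : 0 < c := by linarith
  -- the primitive `v = e^{λ(r−r₁)}/λ` of the exponential
  set v : ℝ → ℂ := fun r => Complex.exp (lam * ((r - r₁ : ℝ) : ℂ)) * lam⁻¹ with hv
  set v' : ℝ → ℂ := fun r => Complex.exp (lam * ((r - r₁ : ℝ) : ℂ)) with hv'
  have hvd : ∀ r, HasDerivAt v (v' r) r := by
    intro r
    have h1 : HasDerivAt (fun r : ℝ => lam * ((r - r₁ : ℝ) : ℂ)) (lam * 1) r := by
      have h0 : HasDerivAt (fun r : ℝ => ((r - r₁ : ℝ) : ℂ)) 1 r := by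
        simpa using ((hasDerivAt_id r).sub_const r₁).ofReal_comp
      exact h0.const_mul lam
    have h2 := (h1.cexp).mul_const lam⁻¹
    refine h2.congr_deriv ?_
    simp only [hv']
    field_simp
  have hnorm : ∀ r, ‖Complex.exp (lam * ((r - r₁ : ℝ) : ℂ))‖ = Real.exp (-c * (r - r₁)) := by
    intro r; rw [norm_exp_mul_sub]; simp [hc]
  have hIci : ∀ r ∈ Ioi r₁, r ∈ Ici r₁ := fun r hr => mem_Ici.2 (le_of_lt (mem_Ioi.1 hr))
  have hfc : ContinuousOn f (Ioi r₁) := fun r hr =>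
    (hf r (hIci r hr)).continuousAt.continuousWithinAt
  have hec : Continuous fun r : ℝ => Complex.exp (lam * ((r - r₁ : ℝ) : ℂ)) :=
    Complex.continuous_exp.comp (continuous_const.mul
      (Complex.continuous_ofReal.comp (continuous_id.sub continuous_const)))
  -- integrability of `f v'` and `f' v`
  have huv' : IntegrableOn (fun r => f r * v' r) (Ioi r₁) := by
    refine integrableOn_Ioi_of_norm_le_exp_mul_pow (C := C) (n := k) hcpos r₁
      (hfc.mul hec.continuousOn) fun r hr => ?_
    rw [norm_mul, hnorm]
    have := hfb r (hIci r hr)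
    have hE := Real.exp_pos (-c * (r - r₁))
    nlinarith
  have hu'v : IntegrableOn (fun r => f' r * v r) (Ioi r₁) := by
    refine integrableOn_Ioi_of_norm_le_exp_mul_pow (C := C * ‖lam⁻¹‖) (n := k) hcpos r₁
      ((hf'c.mono Ioi_subset_Ici_self).mul (hec.mul continuous_const).continuousOn) fun r hr => ?_
    rw [norm_mul, norm_mul, hnorm]
    have := hf'b r (hIci r hr)
    have hE := Real.exp_pos (-c * (r - r₁))
    have hl := norm_nonneg lam⁻¹
    nlinarith [mul_le_mul_of_nonneg_right this (mul_nonneg hE.le hl)]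
  -- boundary behaviour
  have h_zero : Tendsto (f * v) (𝓝[>] r₁) (𝓝 (f r₁ * lam⁻¹)) := by
    have h1 : ContinuousWithinAt (fun r => f r * v r) (Ioi r₁) r₁ :=
      ((hf r₁ self_mem_Ici).continuousAt.mul (hvd r₁).continuousAt).continuousWithinAt
    have h2 : f r₁ * v r₁ = f r₁ * lam⁻¹ := by simp [hv]
    rw [← h2]
    exact h1.tendsto
  have h_infty : Tendsto (f * v) atTop (𝓝 0) := by
    have hlim := (tendsto_pow_mul_exp_neg_mul_sub hcpos r₁ k).const_mul (C * ‖lam⁻¹‖)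
    rw [mul_zero] at hlim
    refine squeeze_zero_norm' ?_ hlim
    filter_upwards [eventually_ge_atTop r₁] with r hr
    show ‖f r * v r‖ ≤ C * ‖lam⁻¹‖ * ((1 + r) ^ k * Real.exp (-c * (r - r₁)))
    simp only [hv]
    rw [norm_mul, norm_mul, hnorm]
    have := hfb r (mem_Ici.2 hr)
    have hE := Real.exp_pos (-c * (r - r₁))
    have hl := norm_nonneg lam⁻¹
    nlinarith [mul_le_mul_of_nonneg_right this (mul_nonneg hE.le hl)]
  have hibp := integral_Ioi_mul_deriv_eq_deriv_mul (fun r hr => hf r (hIci r hr))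
    (fun r _ => hvd r) huv' hu'v h_zero h_infty
  -- `hibp : ∫ f v' = 0 − f(r₁)/λ − ∫ f' v`
  rw [hibp]
  simp only [hv]
  rw [show (fun r => f' r * (Complex.exp (lam * ((r - r₁ : ℝ) : ℂ)) * lam⁻¹)) =
      fun r => (f' r * Complex.exp (lam * ((r - r₁ : ℝ) : ℂ))) * lam⁻¹ by funext r; ring,
    MeasureTheory.integral_mul_const]
  field_simp
  ring

/-- **Iterated integration by parts against a decaying exponential** (TdC Lemma 3.10, the
formulas (g-tilde-IBP-sub)/(derivative-g-tilde-IBP-sub) in abstract form). For `Re λ < 0` and a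
chain `f₀, f₁, …, fₙ` on `[r₁, ∞)` with `fⱼ' = fⱼ₊₁` (`j < n`), all continuous and polynomially
bounded:
`∫_{r₁}^∞ f₀ e^{λ(r−r₁)} = Σ_{j<n} (−1)^{j+1} fⱼ(r₁)/λ^{j+1} + (−1)ⁿ λ^{−n} ∫_{r₁}^∞ fₙ e^{λ(r−r₁)}`.
[cite: Costa2019, Lemma 3.10] -/
theorem integral_Ioi_mul_exp_eq_ibp_iter {lam : ℂ} (hlam : lam.re < 0) {r₁ C : ℝ} {k : ℕ}
    {f : ℕ → ℝ → ℂ} (n : ℕ)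
    (hf : ∀ j, j < n → ∀ r ∈ Ici r₁, HasDerivAt (f j) (f (j + 1) r) r)
    (hfc : ∀ j, j ≤ n → ContinuousOn (f j) (Ici r₁))
    (hfb : ∀ j, j ≤ n → ∀ r ∈ Ici r₁, ‖f j r‖ ≤ C * (1 + r) ^ k) :
    ∫ r in Ioi r₁, f 0 r * Complex.exp (lam * ((r - r₁ : ℝ) : ℂ)) =
      (∑ j ∈ Finset.range n, (-1) ^ (j + 1) * f j r₁ / lam ^ (j + 1)) +
        (-1) ^ n * (lam⁻¹) ^ n *
          ∫ r in Ioi r₁, f n r * Complex.exp (lam * ((r - r₁ : ℝ) : ℂ)) := by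
  induction n with
  | zero => simp
  | succ n ih =>
    have ih' := ih (fun j hj => hf j (Nat.lt_succ_of_lt hj))
      (fun j hj => hfc j (Nat.le_succ_of_le hj)) (fun j hj => hfb j (Nat.le_succ_of_le hj))
    have hstep := integral_Ioi_mul_exp_eq_ibp (f := f n) (f' := f (n + 1)) hlam
      (hf n (Nat.lt_succ_self n)) (hfc (n + 1) le_rfl) (hfb n (Nat.le_succ n))
      (hfb (n + 1) le_rfl)
    rw [ih', hstep, Finset.sum_range_succ]
    ring


/-! ### The integrable rate at `x* = −∞` (input `hint` of `transformedSolution_eq_zero`)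

Along a tortoise radius function `x = R(x*)` the hypothesis "`Ṽ − ω₀²` decays at an integrable
rate as `x* → −∞`" of Lemma 4.1 (2) follows from the Lipschitz rate `Ṽ(x) − ω₀² = O(x − r₊)` of
Remark 3.9 (v): the factor `x − r₊` is dominated by a multiple of `dR/dx* = Δ(R)/(R² + a²)`. -/

/-- **Integrable rate at `−∞` along the tortoise coordinate from a Lipschitz rate at `r₊`.**
Let `R` be a tortoise radius function (`dR/dt = Δ(R)/(R² + a²)`, `Kerr.IsTortoiseRadius`) and
`F` continuous on `(r₊, ∞)` with `|F(x)| ≤ L (x − r₊)` for `r₊ < x ≤ x₁`. Then for `R(t₀) ≤ x₁`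
and all `t ≤ t₀`: `∫ₜ^{t₀} |F(R(τ))| dτ ≤ L (x₁² + a²)/(r₊ − r₋) · (x₁ − r₊)`, uniformly in `t`
(because `x − r₊ ≤ [(x₁²+a²)/(r₊−r₋)] dR/dt` there, so the integrand is dominated by a multiple
of `R'`). This is how the hypothesis `∫ |ω₀² − Ṽ| ≤ K` near `x* = −∞` of
`Costa2019.transformedSolution_eq_zero` follows from `Ṽ(x) − ω₀² = O(x − r₊)`
(TdC Remark 3.9 (v)). [cite: Costa2019, Remark 3.9 (v) and Lemma 4.1 (2) ("decaying at an
integrable rate as `r* → −∞`")] -/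
theorem intervalIntegral_abs_comp_tortoise_le {M a : ℝ} (hMa : IsSubextremal M a) {R : ℝ → ℝ}
    (hR : IsTortoiseRadius M a R) {F : ℝ → ℝ} {L x₁ t₀ : ℝ} (hL : 0 ≤ L)
    (hFc : ContinuousOn F (Ioi (rPlus M a)))
    (hFb : ∀ x, rPlus M a < x → x ≤ x₁ → |F x| ≤ L * (x - rPlus M a)) (ht₀ : R t₀ ≤ x₁)
    {t : ℝ} (ht : t ≤ t₀) :
    ∫ τ in t..t₀, |F (R τ)| ≤
      L * ((x₁ ^ 2 + a ^ 2) / (rPlus M a - rMinus M a)) * (x₁ - rPlus M a) := by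
  have hgap : 0 < rPlus M a - rMinus M a := sub_pos.2 hMa.rMinus_lt_rPlus
  set c : ℝ := (x₁ ^ 2 + a ^ 2) / (rPlus M a - rMinus M a) with hc
  have hx₁ : rPlus M a < x₁ := (hR.rPlus_lt t₀).trans_le ht₀
  have hc0 : 0 ≤ c := by positivity
  -- `R' = Δ(R)/(R²+a²)` is continuous
  set R' : ℝ → ℝ := fun τ => delta M a (R τ) / (R τ ^ 2 + a ^ 2) with hR'
  have hRc : Continuous R := hR.continuous
  have hR'c : Continuous R' := by
    have hΔ : Continuous fun τ => delta M a (R τ) := by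
      unfold delta
      exact ((hRc.pow 2).sub (continuous_const.mul hRc)).add continuous_const
    refine hΔ.div ((hRc.pow 2).add continuous_const) fun τ => (hR.sq_add_sq_pos hMa τ).ne'
  -- on `[t, t₀]`: `R ∈ (r₊, x₁]` and `|F(R)| ≤ L c R'`
  have hmono : StrictMono R := hR.strictMono hMa
  have hdom : ∀ τ ∈ Icc t t₀, |F (R τ)| ≤ L * c * R' τ := by
    intro τ hτ
    have h1 : rPlus M a < R τ := hR.rPlus_lt τ
    have h2 : R τ ≤ x₁ := (hmono.monotone hτ.2).trans ht₀
    have hRpos : 0 < R τ := hR.pos hMa τ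
    have hx1pos : 0 < x₁ := hRpos.trans_le h2
    -- `(R − r₊) ≤ c · Δ(R)/(R²+a²)`
    have hkey : R τ - rPlus M a ≤ c * R' τ := by
      have hden : 0 < R τ ^ 2 + a ^ 2 := hR.sq_add_sq_pos hMa τ
      have hΔ : delta M a (R τ) = (R τ - rPlus M a) * (R τ - rMinus M a) :=
        delta_eq_mul hMa.le (R τ)
      simp only [hR', hc]
      rw [hΔ, div_mul_div_comm, le_div_iff₀ (mul_pos hgap hden)]
      have h3 : rPlus M a - rMinus M a ≤ R τ - rMinus M a := by linarith
      have h4 : R τ ^ 2 + a ^ 2 ≤ x₁ ^ 2 + a ^ 2 := by nlinarith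
      have h5 : 0 ≤ R τ - rPlus M a := by linarith
      calc (R τ - rPlus M a) * ((rPlus M a - rMinus M a) * (R τ ^ 2 + a ^ 2)) =
          ((R τ - rPlus M a) * (R τ ^ 2 + a ^ 2)) * (rPlus M a - rMinus M a) := by ring
        _ ≤ ((R τ - rPlus M a) * (x₁ ^ 2 + a ^ 2)) * (R τ - rMinus M a) :=
            mul_le_mul (mul_le_mul_of_nonneg_left h4 h5) h3 hgap.le (by positivity)
        _ = (x₁ ^ 2 + a ^ 2) * ((R τ - rPlus M a) * (R τ - rMinus M a)) := by ring
    calc |F (R τ)| ≤ L * (R τ - rPlus M a) := hFb _ h1 h2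
      _ ≤ L * (c * R' τ) := mul_le_mul_of_nonneg_left hkey hL
      _ = L * c * R' τ := by ring
  -- integrate
  have hFRc : ContinuousOn (fun τ => |F (R τ)|) (Icc t t₀) := by
    refine ContinuousOn.abs (hFc.comp hRc.continuousOn fun τ _ => hR.rPlus_lt τ)
  have hI1 : IntervalIntegrable (fun τ => |F (R τ)|) MeasureTheory.volume t t₀ :=
    (hFRc.mono (by rw [uIcc_of_le ht])).intervalIntegrable
  have hI2 : IntervalIntegrable (fun τ => L * c * R' τ) MeasureTheory.volume t t₀ :=
    ((continuous_const.mul hR'c).continuousOn).intervalIntegrable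
  have hFTC : ∫ τ in t..t₀, R' τ = R t₀ - R t :=
    integral_eq_sub_of_hasDerivAt (fun τ _ => hR.hasDerivAt τ) (hR'c.intervalIntegrable _ _)
  calc ∫ τ in t..t₀, |F (R τ)| ≤ ∫ τ in t..t₀, L * c * R' τ :=
        integral_mono_on ht hI1 hI2 hdom
    _ = L * c * (R t₀ - R t) := by rw [intervalIntegral.integral_const_mul, hFTC]
    _ ≤ L * c * (x₁ - rPlus M a) := by
        refine mul_le_mul_of_nonneg_left ?_ (mul_nonneg hL hc0)
        linarith [hR.rPlus_lt t]


/-! ### Asymptotic toolkit, VII: the explicit amplitude at infinity in inverted coordinates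

For the `y → 0` limit of Whiting's transform the amplitude `Φ = (r−r₋)^η (r−r₊)^ξ e^{γr} R` is
split according to the outgoing expansion `R = F_N + E_N` (`Kerr.IsOutgoingAtInfinity`): the
`E_N`-part is absolutely integrable, and the explicit `F_N`-part is
`(r−r₋)^η (r−r₊)^ξ r^{2iMω} · Σ cₖ r^{−2s−k−1} = H(1/r) · Σ cₖ r^{−2s−k−1}` with
`H(u) = (1 − r₋u)^η (1 − r₊u)^ξ` smooth at `u = 0` (`amplitude_inversion`,
`contDiffOn_invertedAmplitude`); a finite Taylor expansion of `H` (`exists_taylor_poly_bound`)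
then reduces it to finitely many pure powers `r^q` plus an absolutely integrable remainder. -/

/-- **Taylor expansion at `0` with an `O(u^{J+1})` remainder** (complex-valued, on `[0, u₀]`):
a `C^{J+1}` function on `[0, u₀]` differs from a polynomial `Σ_{j≤J} aⱼ uʲ` by at most
`C u^{J+1}`. [folklore] -/
theorem exists_taylor_poly_bound {H : ℝ → ℂ} {u₀ : ℝ} (hu₀ : 0 < u₀) (J : ℕ)
    (hH : ContDiffOn ℝ (J + 1) H (Icc 0 u₀)) :
    ∃ (a : ℕ → ℂ) (C : ℝ), ∀ u ∈ Icc 0 u₀,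
      ‖H u - ∑ j ∈ Finset.range (J + 1), a j * u ^ j‖ ≤ C * u ^ (J + 1) := by
  have hU : UniqueDiffOn ℝ (Icc (0 : ℝ) u₀) := uniqueDiffOn_Icc hu₀
  have hcont : ContinuousOn (iteratedDerivWithin (J + 1) H (Icc 0 u₀)) (Icc 0 u₀) :=
    hH.continuousOn_iteratedDerivWithin (by exact_mod_cast le_rfl) hU
  obtain ⟨C₀, hC₀⟩ := isCompact_Icc.exists_bound_of_continuousOn hcont
  refine ⟨fun j => (((Nat.factorial j : ℝ)⁻¹ : ℝ) : ℂ) * iteratedDerivWithin j H (Icc 0 u₀) 0,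
    C₀ / Nat.factorial J, fun u hu => ?_⟩
  have h := taylor_mean_remainder_bound hu₀.le hH hu hC₀
  have heq : taylorWithinEval H J (Icc 0 u₀) 0 u =
      ∑ j ∈ Finset.range (J + 1), (((Nat.factorial j : ℝ)⁻¹ : ℝ) : ℂ) *
        iteratedDerivWithin j H (Icc 0 u₀) 0 * u ^ j := by
    rw [taylor_within_apply]
    refine Finset.sum_congr rfl fun j _ => ?_
    rw [sub_zero, Complex.real_smul]
    push_cast
    ring
  rw [heq] at h
  calc _ ≤ C₀ * (u - 0) ^ (J + 1) / Nat.factorial J := h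
    _ = C₀ / Nat.factorial J * u ^ (J + 1) := by rw [sub_zero]; ring

/-- `u ↦ (1 − c u)^p` (principal complex power of the positive real `1 − cu`) is smooth where
`1 − c u > 0`. [folklore] -/
theorem contDiffOn_one_sub_mul_cpow (c : ℝ) (p : ℂ) :
    ContDiffOn ℝ ((⊤ : ℕ∞) : WithTop ℕ∞) (fun u : ℝ => (((1 - c * u : ℝ) : ℂ)) ^ p)
      {u : ℝ | 0 < 1 - c * u} := by
  intro u hu
  have hpos : (0 : ℝ) < 1 - c * u := hu
  have hslit : (((1 - c * u : ℝ) : ℂ)) ∈ Complex.slitPlane := Complex.ofReal_mem_slitPlane.2 hpos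
  have h1 : AnalyticAt ℂ (fun z : ℂ => z ^ p) ((1 - c * u : ℝ) : ℂ) :=
    analyticAt_id.cpow analyticAt_const hslit
  have h3a : AnalyticAt ℝ (fun v : ℝ => 1 - c * v) u :=
    analyticAt_const.sub (analyticAt_const.mul analyticAt_id)
  have h3 : AnalyticAt ℝ (fun v : ℝ => ((1 - c * v : ℝ) : ℂ)) u :=
    AnalyticAt.comp (g := fun y : ℝ => (y : ℂ)) (f := fun v : ℝ => 1 - c * v) (x := u)
      (Complex.ofRealCLM.analyticAt (1 - c * u)) h3a
  have h4 : AnalyticAt ℝ (fun v : ℝ => (((1 - c * v : ℝ) : ℂ)) ^ p) u :=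
    AnalyticAt.comp (g := fun z : ℂ => z ^ p) (f := fun v : ℝ => ((1 - c * v : ℝ) : ℂ)) (x := u)
      h1.restrictScalars h3
  exact h4.contDiffAt.contDiffWithinAt

/-- The oscillation-free amplitude factor in inverted coordinates:
`H(u) = (1 − r₋ u)^η (1 − r₊ u)^ξ` is smooth on `[0, 1/(2r₊)]` (`0 ≤ r₋ ≤ r₊`, `r₊ > 0`).
[cite: Costa2019, §3.2.3 (asymptotics of `g̃` for large `x`)] -/
theorem contDiffOn_invertedAmplitude {M a : ℝ} (hM : 0 < M) (ha : |a| < M) (ω m : ℝ) :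
    ContDiffOn ℝ ((⊤ : ℕ∞) : WithTop ℕ∞) (fun u : ℝ => (((1 - rMinus M a * u : ℝ) : ℂ)) ^ innerExponent M a ω m *
      (((1 - rPlus M a * u : ℝ) : ℂ)) ^ horizonExponent M a ω m) (Icc 0 (1 / (2 * rPlus M a))) := by
  have hrp : 0 < rPlus M a := rPlus_pos hM a
  have hrm : 0 ≤ rMinus M a := IsSubextremal.rMinus_nonneg ha
  have hle : rMinus M a ≤ rPlus M a := rMinus_le_rPlus M a
  have hsub : Icc (0 : ℝ) (1 / (2 * rPlus M a)) ⊆ {u : ℝ | 0 < 1 - rPlus M a * u} := by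
    intro u hu
    show 0 < 1 - rPlus M a * u
    have h2 : rPlus M a * u ≤ rPlus M a * (1 / (2 * rPlus M a)) :=
      mul_le_mul_of_nonneg_left hu.2 hrp.le
    have h3 : rPlus M a * (1 / (2 * rPlus M a)) = 1 / 2 := by field_simp
    linarith
  have hsub' : Icc (0 : ℝ) (1 / (2 * rPlus M a)) ⊆ {u : ℝ | 0 < 1 - rMinus M a * u} := by
    intro u hu
    show 0 < 1 - rMinus M a * u
    have h1 : rMinus M a * u ≤ rPlus M a * u := mul_le_mul_of_nonneg_right hle hu.1
    have h2 : 0 < 1 - rPlus M a * u := hsub hu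
    linarith
  have hA := (contDiffOn_one_sub_mul_cpow (rMinus M a) (innerExponent M a ω m)).mono hsub'
  have hB := (contDiffOn_one_sub_mul_cpow (rPlus M a) (horizonExponent M a ω m)).mono hsub
  exact hA.mul hB

/-- **Inversion identity for the amplitude factor.** For `r > r₊` (`> 0`, `r₋ ≥ 0`):
`(r − r₋)^η (r − r₊)^ξ r^{2iMω} = (1 − r₋/r)^η (1 − r₊/r)^ξ` (using `η + ξ = −2iMω`; principal
powers of positive reals, which multiply). [cite: Costa2019, §3.2.3] -/
theorem amplitude_inversion {M a : ℝ} (hM : 0 < M) (ha : |a| < M) (ω m : ℝ) {r : ℝ}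
    (hr : rPlus M a < r) :
    ((r - rMinus M a : ℝ) : ℂ) ^ innerExponent M a ω m *
        ((r - rPlus M a : ℝ) : ℂ) ^ horizonExponent M a ω m * (r : ℂ) ^ (2 * Complex.I * M * ω) =
      (((1 - rMinus M a * r⁻¹ : ℝ) : ℂ)) ^ innerExponent M a ω m *
        (((1 - rPlus M a * r⁻¹ : ℝ) : ℂ)) ^ horizonExponent M a ω m := by
  have hrp : 0 < rPlus M a := rPlus_pos hM a
  have hr0 : 0 < r := hrp.trans hr
  have hq : rMinus M a < r := (rMinus_le_rPlus M a).trans_lt hr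
  have hrc : (r : ℂ) ≠ 0 := by exact_mod_cast hr0.ne'
  -- `r − r± = r · (1 − r±/r)` with both factors non-negative
  have h1 : r - rMinus M a = r * (1 - rMinus M a * r⁻¹) := by field_simp
  have h2 : r - rPlus M a = r * (1 - rPlus M a * r⁻¹) := by field_simp
  have hnn1 : 0 ≤ 1 - rMinus M a * r⁻¹ := by
    have : r - rMinus M a = r * (1 - rMinus M a * r⁻¹) := h1
    nlinarith [sub_pos.2 hq]
  have hnn2 : 0 ≤ 1 - rPlus M a * r⁻¹ := by
    have : r - rPlus M a = r * (1 - rPlus M a * r⁻¹) := h2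
    nlinarith [sub_pos.2 hr]
  rw [h1, h2, Complex.ofReal_mul, Complex.ofReal_mul, Complex.mul_cpow_ofReal_nonneg hr0.le hnn1,
    Complex.mul_cpow_ofReal_nonneg hr0.le hnn2]
  have hsum : innerExponent M a ω m + horizonExponent M a ω m + 2 * Complex.I * M * ω = 0 := by
    have h3 : (rPlus M a : ℂ) - (rMinus M a : ℂ) ≠ 0 := by
      rw [← Complex.ofReal_sub]
      exact_mod_cast (sub_pos.2 (IsSubextremal.rMinus_lt_rPlus ha)).ne'
    unfold innerExponent
    rw [horizonExponent_eq hM ha]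
    push_cast
    field_simp
    ring
  calc (r : ℂ) ^ innerExponent M a ω m * (((1 - rMinus M a * r⁻¹ : ℝ) : ℂ)) ^ innerExponent M a ω m *
        ((r : ℂ) ^ horizonExponent M a ω m * (((1 - rPlus M a * r⁻¹ : ℝ) : ℂ)) ^ horizonExponent M a ω m) *
        (r : ℂ) ^ (2 * Complex.I * M * ω) =
      ((r : ℂ) ^ innerExponent M a ω m * (r : ℂ) ^ horizonExponent M a ω m *
        (r : ℂ) ^ (2 * Complex.I * M * ω)) *
        ((((1 - rMinus M a * r⁻¹ : ℝ) : ℂ)) ^ innerExponent M a ω m *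
          (((1 - rPlus M a * r⁻¹ : ℝ) : ℂ)) ^ horizonExponent M a ω m) := by ring
    _ = (r : ℂ) ^ (innerExponent M a ω m + horizonExponent M a ω m + 2 * Complex.I * M * ω) *
        ((((1 - rMinus M a * r⁻¹ : ℝ) : ℂ)) ^ innerExponent M a ω m *
          (((1 - rPlus M a * r⁻¹ : ℝ) : ℂ)) ^ horizonExponent M a ω m) := by
        rw [Complex.cpow_add _ _ hrc, Complex.cpow_add _ _ hrc]
    _ = _ := by rw [hsum, Complex.cpow_zero, one_mul]

end Costa2019

end Literature.Geometry.Lorentzian.Kerr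

end
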